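import Summits.ABC.ABC.Theses.TwistAmplification
import Summits.ABC.ABC.Theorems.SomeWindowSaving.Negative.LoadBearing
import Literature.NumberTheory.EllipticCurves.SzpiroLocalDataProofs
import Literature.NumberTheory.EllipticCurves.SzpiroBGEquivalenceProofs
import Literature.Barriers.ABC.UniformABCDiscriminantSharpProofs
import Literature.NumberTheory.EllipticCurves.SzpiroFreyProofs
import Literature.NumberTheory.EllipticCurves.SzpiroOfAbcProofs

/-!
# Disproof of `ModerateWindowCount` (crux stmt-ABC-1973, route-ABC-TwistAmplification) — findings

Standing adversary file (cdisprove), refuter-cdisprove-stmt-ABC-1973-0, 2026-08-16.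

**VERDICT: the crux RESISTS, and it must: as typed it is EQUIVALENT to the summit.**
`ModerateWindowCount` (MWC) = `∀ σ > 6 ∃ κ ∈ (3,σ) ∃ δ < (σ−κ)/(2σ−6) ∃ C ∀ X ≥ 1, T_[κ,σ](X) ≤ C X^δ`.
Because `κ` may be taken in `(6, σ)`, the generalized Szpiro conjecture (Bombieri–Gubler 12.5.11,
equivalent to abc by B–G 12.5.12, PROVED in the tree as `abcLe_iff_generalizedSzpiroBG_holds`) empties
every window `[κ, σ]`, `κ > 6`, above a bounded conductor, so `ABC → MWC` (§3, checked:
`moderateWindowCount_of_abc`); the route proves `MWC → ABC`. Hence every disproof of the crux is a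
disproof of abc, and no counterexample search / small model / degenerate regime can touch it.
What CAN be certified is WHERE the statement sits: (§2) the clause `κ < σ` is an honesty clause —
without it the statement is trivially true (empty windows); (§4, the main theorem of this file)
the hypothesis `6 < σ` is SHARP: at `σ = 6` the conclusion is FALSE for EVERY `κ ∈ (3,6)` and EVERY
`δ < (6−κ)/6`, by twist amplification run on the unconditional quality-≥-1 triples `1 + (p^j − 1) = p^j`
— the counting form of `Literature.Barriers.ABC.SzpiroEpsilonCannotBeDropped` and a proof that the
route's threshold `(σ−κ)/(2σ−6)` is attained on the nose at `σ = 6`.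

## Contents (Lean; everything `sorry`-free unless marked NEAR-MISS)
* §1 the counted set is the LANDED `windowSet` / `windowCount` / `windowSet_finite` of the sibling crux's
  negative files (`Theorems/SomeWindowSaving/Negative/{Defs,WindowFinite,LoadBearing}.lean`, same route, same
  set verbatim); here: `moderateWindowCount_iff` (`Iff.rfl`) and monotonicity.
* §2 DEGENERATE CASES. Conductor-1 curves never enter a window (`not_mem_windowSet_of_maxInv_le_one`, landed),
  hence `windowSet_eq_empty_of_lt` (`σ < κ` ⇒ empty). HONESTY: `moderateWindowCountWithoutKappaLtSigma_trivial`
  — drop `κ < σ` and the statement is provable outright (`κ := σ + 1`, `δ := −1`, `C := 0`).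
* §3 THE LOOPHOLE, FORMALLY. `moderateWindowCount_of_generalizedSzpiroBG`, `moderateWindowCount_of_abc`
  (`κ := 6 + (σ−6)/2`, `ε := (σ−6)/4`, `δ := 0`, `C := T_[κ,σ](N₁)` with `N₁ = max(C_ε,1)^{4/(σ−6)}`).
  POSITIVE lemmas (prover-side evidence, not a refuter landing): the crux cannot fail with abc true,
  contrary to the gloss "a counting statement that could fail with ABC true" in the item text — that gloss
  needs `κ < 6` (crux `SharpModerateLaw`).
* §4 `6 < σ` IS SHARP — `not_windowLaw_le_six`: for `3 < κ < σ ≤ 6`, NO `δ < (6−κ)/6 = 1 − κ/6` and no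
  `C` give `T_[κ,σ](X) ≤ C X^δ`; hence `not_moderateWindowLawAtSix` (¬ of the crux's conclusion at `σ = 6`,
  for ALL `κ, δ, C`; axioms `propext, Classical.choice, Quot.sound`), `not_moderateWindowCountFromSix`
  (`6 ≤ σ` version false), `moderateWindowCount_false_without_sixLtSigma` (hypothesis dropped ⇒ false),
  `no_windowSaving_le_six` + `someWindowSaving_sigma_gt_six` (the sibling crux `SomeWindowSaving`,
  stmt-ABC-1976, can only be witnessed with `σ > 6`), and the TIGHTNESS floor `T_not_bigO_below_law`
  (for `κ < 6` and any `σ > κ`: `T_[κ,σ](X) ≠ O(X^δ)` for `δ < 1 − κ/6`, so an MWC witness with `κ < 6` lives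
  in the strip `1 − κ/6 ≤ δ < (σ−κ)/(2σ−6)` of width = the margin identity). Ingredients, all certified here:
  the reduced twisted Frey models `tf α k` (§4.1), their minimality and EXACT conductor `N = d²·p·rad k` (§4.2,
  from `SzpiroLocalDataProofs`), window membership in log form and `M⁺ = d⁶ m³` (§4.3), Chebyshev prime supply
  with explicit thresholds, and the endgame (§4.4) whose exponent bookkeeping is uniform in the uncertified
  radical `rad k` (this is the point: no squarefree-value theorem is needed).
* §6 MINIMALITY IS LOAD-BEARING (certified): `moderateWindowCount_false_without_minimality` — with
  "minimal at every place" dropped the statement is FALSE (instance `σ = 7`, every `κ ∈ (3,7)`,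
  `δ < (7−κ)/8`): the rescalings `sc b k = y² = x³ − b²k⁴x + b³k⁶` of the prime twists `tw b`
  (conductor `∈ [b², 368b²]` independent of `k`, `M⁺ = 110592 b⁶k¹²`) put `≫ X^{1/2+2(1−η)/6}/log X`
  members in the window — the `κ > 6` escape does not help against rescalings.
* §7 REDUCEDNESS is an honesty clause (certified): `moderateWindowCountUnreduced_trivial` — without the
  reducedness clauses every window is empty or infinite (integral translates), `ncard = 0`, TRIVIALLY true.
* §5 Hypothesis audit for the TARGET as typed (paper + pointers): `c₄ ≠ 0`, `c₆ ≠ 0` are NOT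
  load-bearing for MWC (the ∃κ escapes to `κ > 5`, where CM sources are bounded:
  `|Δ| ≤ 6¹¹ N⁵` on `c₄ = 0`, `|c₄|³ ≤ 6⁹·N^{9/2}` on `c₆ = 0`), in contrast with `SharpModerateLaw`
  where each is load-bearing (sibling file §§3,5,6); minimality IS (§6); reducedness and `κ < σ` are
  honesty clauses; `6 < σ` is sharp (§4); the radical proxy only forces `κ > 6`.
-/

set_option linter.dupNamespace false

namespace Summit.ABC.ABC.Cruxes.ModerateWindowCount.Disproof

open Summit.ABC.ABC.Theses.TwistAmplification WeierstrassCurve IsDedekindDomain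
open Summit.ABC.ABC.Theorems.SomeWindowSaving.Negative

noncomputable section

/-! ## 1. The counted set: the crux through the landed `windowSet` / `windowCount`
(`Theorems/SomeWindowSaving/Negative/Defs.lean`, same route, same set verbatim), monotonicity -/

/-- The crux is literally the statement about `windowCount` (definitional). -/
theorem moderateWindowCount_iff :
    ModerateWindowCount ↔ ∀ σ : ℝ, 6 < σ → ∃ κ δ C : ℝ, 3 < κ ∧ κ < σ ∧ δ < (σ - κ) / (2 * σ - 6) ∧
      ∀ X : ℝ, 1 ≤ X → (windowCount κ σ X : ℝ) ≤ C * X ^ δ :=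
  Iff.rfl

/-! ### 1.2 Monotonicity -/

/-- The conductor of a window member is `≥ 1` (as a real number). -/
theorem one_le_conductor_of_mem {κ σ X : ℝ} {W : WeierstrassCurve ℤ} (hW : W ∈ windowSet κ σ X) :
    (1 : ℝ) ≤ (((W.baseChange ℚ).conductorNorm ℤ : ℕ) : ℝ) := by
  haveI := hW.1
  exact_mod_cast conductorNorm_pos_holds (W.baseChange ℚ)

/-- Windows grow when `κ` decreases and `σ` increases. -/
theorem windowSet_mono {κ κ' σ σ' : ℝ} (hκ : κ' ≤ κ) (hσ : σ ≤ σ') (X : ℝ) :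
    windowSet κ σ X ⊆ windowSet κ' σ' X := by
  intro W hW
  have h1 := one_le_conductor_of_mem hW
  obtain ⟨hE, hmin, h₁, h₃, h₂, hc₄, hc₆, hNX, hlo, hhi⟩ := hW
  refine ⟨hE, hmin, h₁, h₃, h₂, hc₄, hc₆, hNX, ?_, ?_⟩
  · exact (Real.rpow_le_rpow_of_exponent_le h1 hκ).trans hlo
  · exact hhi.trans (Real.rpow_le_rpow_of_exponent_le h1 hσ)

/-- Membership only uses `N ≤ X`. -/
theorem mem_windowSet_of_conductor_le {κ σ X Y : ℝ} {W : WeierstrassCurve ℤ} (hW : W ∈ windowSet κ σ X)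
    (hY : (((W.baseChange ℚ).conductorNorm ℤ : ℕ) : ℝ) ≤ Y) : W ∈ windowSet κ σ Y := by
  obtain ⟨hE, hmin, h₁, h₃, h₂, hc₄, hc₆, -, hlo, hhi⟩ := hW
  exact ⟨hE, hmin, h₁, h₃, h₂, hc₄, hc₆, hY, hlo, hhi⟩

/-- Windows grow with `X`. -/
theorem windowSet_mono_X (κ σ : ℝ) {X X' : ℝ} (hX : X ≤ X') : windowSet κ σ X ⊆ windowSet κ σ X' :=
  fun _ hW => mem_windowSet_of_conductor_le hW (hW.2.2.2.2.2.2.2.1.trans hX)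

/-- `windowCount` is antitone in `κ` and monotone in `σ`. -/
theorem windowCount_mono {κ κ' σ σ' : ℝ} (hκ : κ' ≤ κ) (hσ : σ ≤ σ') (X : ℝ) :
    windowCount κ σ X ≤ windowCount κ' σ' X :=
  Set.ncard_le_ncard (windowSet_mono hκ hσ X) (windowSet_finite _ _ _)

/-- `windowCount` is monotone in `X`. -/
theorem windowCount_mono_X (κ σ : ℝ) {X X' : ℝ} (hX : X ≤ X') : windowCount κ σ X ≤ windowCount κ σ X' :=
  Set.ncard_le_ncard (windowSet_mono_X κ σ hX) (windowSet_finite _ _ _)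

/-! ## 2. Degenerate cases: conductor `1`, windows with `σ < κ`, and the honesty clause `κ < σ`

The only degenerate instance of the counted predicate is `N = 1` (then `N^κ = N^σ = 1` for all real
exponents and the window condition reads `M⁺ = 1`); it is EMPTY by the landed
`not_mem_windowSet_of_maxInv_le_one` (`Theorems/SomeWindowSaving/Negative/LoadBearing.lean`: an integral
model with `Δ ≠ 0`, `c₄ ≠ 0`, `max |Δ| |c₄|³ = 1` would have `c₆² = c₄³ − 1728Δ ∈ {±1727, ±1729}`).
Consequence: a window with `σ < κ` is empty, so the clause `κ < σ` of the crux is exactly what keeps the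
statement from being trivially true (the `∀σ ∃κ` analogue of `someWindowSaving_trivial_without_upperSigma`). -/

/-- Window members have `M⁺ ≥ 2` (from the landed `not_mem_windowSet_of_maxInv_le_one`:
`M⁺ = 1` would force `|Δ| = |c₄| = 1`, and `c₆² = c₄³ − 1728Δ ∈ {±1727, ±1729}` has no solution). -/
theorem two_le_maxInv_of_mem {κ σ X : ℝ} {W : WeierstrassCurve ℤ} (hW : W ∈ windowSet κ σ X) :
    (2 : ℝ) ≤ ((max |W.Δ| (|W.c₄| ^ 3) : ℤ) : ℝ) := by
  by_contra h
  push Not at h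
  have h1 : max |W.Δ| (|W.c₄| ^ 3) ≤ 1 := by
    have : ((max |W.Δ| (|W.c₄| ^ 3) : ℤ) : ℝ) < ((2 : ℤ) : ℝ) := by exact_mod_cast h
    have := (Int.cast_lt (R := ℝ)).mp this
    omega
  exact not_mem_windowSet_of_maxInv_le_one hW (by exact_mod_cast h1)

/-- Window members have conductor `N ≥ 2` (as a real number): `N = 1` would force `M⁺ = 1`. -/
theorem two_le_conductor_of_mem {κ σ X : ℝ} {W : WeierstrassCurve ℤ} (hW : W ∈ windowSet κ σ X) :
    (2 : ℝ) ≤ (((W.baseChange ℚ).conductorNorm ℤ : ℕ) : ℝ) := by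
  have h1 := one_le_conductor_of_mem hW
  have hM := two_le_maxInv_of_mem hW
  obtain ⟨-, -, -, -, -, -, -, -, -, hhi⟩ := hW
  set N : ℕ := (W.baseChange ℚ).conductorNorm ℤ with hN
  have hN1 : 1 ≤ N := by exact_mod_cast h1
  rcases hN1.eq_or_lt with h | h
  · exfalso
    rw [← h] at hhi
    simp only [Nat.cast_one, Real.one_rpow] at hhi
    linarith
  · have : 2 ≤ N := h
    exact_mod_cast this

/-- **Windows with `σ < κ` are empty.** -/
theorem windowSet_eq_empty_of_lt {κ σ : ℝ} (h : σ < κ) (X : ℝ) : windowSet κ σ X = ∅ := by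
  ext W
  simp only [Set.mem_empty_iff_false, iff_false]
  intro hW
  have h2 := two_le_conductor_of_mem hW
  obtain ⟨-, -, -, -, -, -, -, -, hlo, hhi⟩ := hW
  have : (((W.baseChange ℚ).conductorNorm ℤ : ℕ) : ℝ) ^ σ <
      (((W.baseChange ℚ).conductorNorm ℤ : ℕ) : ℝ) ^ κ :=
    Real.rpow_lt_rpow_of_exponent_lt (by linarith) h
  linarith

theorem windowCount_eq_zero_of_lt {κ σ : ℝ} (h : σ < κ) (X : ℝ) : windowCount κ σ X = 0 := by
  rw [windowCount, windowSet_eq_empty_of_lt h, Set.ncard_empty]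

/-- The crux with the clause `κ < σ` dropped. -/
def ModerateWindowCountWithoutKappaLtSigma : Prop :=
  ∀ σ : ℝ, 6 < σ → ∃ κ δ C : ℝ, 3 < κ ∧ δ < (σ - κ) / (2 * σ - 6) ∧
    ∀ X : ℝ, 1 ≤ X → (windowCount κ σ X : ℝ) ≤ C * X ^ δ

/-- **HONESTY CLAUSE `κ < σ`.** Without it the crux is provable outright: take `κ := σ + 1` (empty
windows), `δ := −1 < −1/(2σ−6)`, `C := 0`. So any purported proof of the crux that never uses
`κ < σ` in an essential way has proved nothing. -/
theorem moderateWindowCountWithoutKappaLtSigma_trivial : ModerateWindowCountWithoutKappaLtSigma := by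
  intro σ hσ
  refine ⟨σ + 1, -1, 0, by linarith, ?_, fun X _ => ?_⟩
  · have h26 : (6 : ℝ) < 2 * σ - 6 := by linarith
    rw [lt_div_iff₀ (by linarith)]
    linarith
  · rw [windowCount_eq_zero_of_lt (by linarith)]
    simp

/-! #### Counting tools -/

/-- A finite family of window members, injectively labelled, bounds `T` from below. -/
theorem card_le_windowCount_of_forall_mem {κ σ X : ℝ} (S : Finset ℕ) (F : ℕ → WeierstrassCurve ℤ)
    (hinj : Set.InjOn F ↑S) (hmem : ∀ d ∈ S, F d ∈ windowSet κ σ X) : S.card ≤ windowCount κ σ X := by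
  classical
  have hsub : (↑(S.image F) : Set (WeierstrassCurve ℤ)) ⊆ windowSet κ σ X := by
    intro W hW
    rw [Finset.coe_image] at hW
    obtain ⟨d, hd, rfl⟩ := hW
    exact hmem d hd
  have h1 : S.card = (S.image F).card := (Finset.card_image_of_injOn hinj).symm
  have h2 : (S.image F).card = Set.ncard (↑(S.image F) : Set (WeierstrassCurve ℤ)) :=
    (Set.ncard_coe_finset _).symm
  have h3 := Set.ncard_le_ncard hsub (windowSet_finite _ _ _)
  unfold windowCount; rw [h1, h2]; exact h3

/-! #### Prime supply (Chebyshev): `#{A < p ≤ T} · log T ≥ T/4` for `T ≥ T₀`, `T ≥ 6A + 1` -/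

/-- The primes in `(A, T]`. -/
def primesIoc (A T : ℕ) : Finset ℕ := (Finset.Ioc A T).filter Nat.Prime

open Chebyshev in
theorem theta_split_gen {A T : ℕ} (hT : A ≤ T) :
    θ (T : ℝ) = θ (A : ℝ) + ∑ p ∈ primesIoc A T, Real.log p := by
  rw [theta_eq_sum_primesLE_log T, theta_eq_sum_primesLE_log A]
  have hU : Nat.primesLE T = Nat.primesLE A ∪ primesIoc A T := by
    ext p
    simp only [Nat.mem_primesLE, primesIoc, Finset.mem_union, Finset.mem_filter, Finset.mem_Ioc]
    constructor
    · rintro ⟨hpT, hp⟩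
      by_cases h : p ≤ A
      · exact Or.inl ⟨h, hp⟩
      · exact Or.inr ⟨⟨by omega, hpT⟩, hp⟩
    · rintro (⟨h, hp⟩ | ⟨⟨-, h⟩, hp⟩)
      · exact ⟨h.trans hT, hp⟩
      · exact ⟨h, hp⟩
  have hD : Disjoint (Nat.primesLE A) (primesIoc A T) := by
    rw [Finset.disjoint_left]
    intro p hp hp'
    rw [Nat.mem_primesLE] at hp
    rw [primesIoc, Finset.mem_filter, Finset.mem_Ioc] at hp'
    omega
  rw [hU, Finset.sum_union hD]

theorem sum_log_primesIoc_le (A T : ℕ) :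
    ∑ p ∈ primesIoc A T, Real.log p ≤ (primesIoc A T).card * Real.log T := by
  have h : ∀ p ∈ primesIoc A T, Real.log p ≤ Real.log T := by
    intro p hp
    rw [primesIoc, Finset.mem_filter, Finset.mem_Ioc] at hp
    exact Real.log_le_log (by exact_mod_cast hp.2.pos) (by exact_mod_cast hp.1.2)
  calc ∑ p ∈ primesIoc A T, Real.log p ≤ ∑ _p ∈ primesIoc A T, Real.log T := Finset.sum_le_sum h
    _ = (primesIoc A T).card * Real.log T := by rw [Finset.sum_const, nsmul_eq_mul]

open Chebyshev in
/-- **Prime supply** with explicit thresholds (Chebyshev, via `eventually_theta_ge_half` and Mathlib's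
`theta_le_log4_mul_x`). -/
theorem primesIoc_card_mul_log_ge :
    ∃ T₀ : ℕ, ∀ A T : ℕ, T₀ ≤ T → 6 * A + 1 ≤ T → (T : ℝ) / 4 ≤ (primesIoc A T).card * Real.log T := by
  obtain ⟨T₀, hT₀⟩ := Literature.Barriers.ABC.eventually_theta_ge_half
  refine ⟨T₀, fun A T hT hTA => ?_⟩
  have h1 := hT₀ T hT
  have h2 := theta_split_gen (A := A) (T := T) (by omega)
  have h3 := sum_log_primesIoc_le A T
  have h4 : θ (A : ℝ) ≤ Real.log 4 * (A : ℝ) := theta_le_log4_mul_x (by positivity)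
  have hlog4 : Real.log 4 < 1.3863 := by
    have : Real.log 4 = 2 * Real.log 2 := by
      rw [show (4 : ℝ) = 2 ^ 2 by norm_num, Real.log_pow]; norm_num
    rw [this]
    have := Real.log_two_lt_d9
    linarith
  have hT' : 6 * (A : ℝ) + 1 ≤ T := by exact_mod_cast hTA
  have hA0 : (0 : ℝ) ≤ A := by positivity
  have h5 : Real.log 4 * (A : ℝ) ≤ 1.3863 * A := mul_le_mul_of_nonneg_right hlog4.le hA0
  nlinarith

/-! ## 3. The `∃ κ` loophole made formal: `GeneralizedSzpiro → MWC`, hence `ABC → MWC`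

With `κ ∈ (6, σ)` allowed, generalized Szpiro (`M⁺ ≤ C_ε N^{6+ε}` for minimal models, B–G 12.5.11)
bounds the conductor of every member of `windowSet κ σ X` by `N₁ := max(C_ε,1)^{1/(κ−6−ε)}`, independently of
`X`; so `T_[κ,σ](X) ≤ T_[κ,σ](N₁)` is bounded and `δ := 0 < (σ−κ)/(2σ−6)` works. Since abc ⟺ generalized
Szpiro is a theorem of the tree (`abcLe_iff_generalizedSzpiroBG_holds`, B–G 12.5.12), the crux as typed is
implied by the summit. (POSITIVE lemmas: evidence for the planner that the crux is summit-equivalent; a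
prover may cite them, a refuter cannot land them.) -/

open Literature.NumberTheory.EllipticCurves in
/-- `GeneralizedSzpiroConjectureBG → ModerateWindowCount`. -/
theorem moderateWindowCount_of_generalizedSzpiroBG (h : GeneralizedSzpiroConjectureBG) :
    ModerateWindowCount := by
  rw [moderateWindowCount_iff]
  intro σ hσ
  -- parameters
  set κ : ℝ := 6 + (σ - 6) / 2 with hκ
  set ε : ℝ := (σ - 6) / 4 with hε
  have hε0 : 0 < ε := by rw [hε]; linarith
  set γ : ℝ := κ - (6 + ε) with hγ
  have hγ0 : 0 < γ := by rw [hγ, hκ, hε]; linarith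
  obtain ⟨C, hC⟩ := h ε hε0
  set B : ℝ := max C 1 with hB
  have hB1 : 1 ≤ B := le_max_right _ _
  set N₁ : ℝ := B ^ (1 / γ) with hN₁
  -- every member of any window has conductor ≤ N₁
  have key : ∀ X : ℝ, ∀ W ∈ windowSet κ σ X, (((W.baseChange ℚ).conductorNorm ℤ : ℕ) : ℝ) ≤ N₁ := by
    intro X W hW
    have hN1 := one_le_conductor_of_mem hW
    obtain ⟨hE, hmin, -, -, -, -, -, -, hlo, -⟩ := hW
    have hSz := hC W hE hmin
    set N : ℝ := (((W.baseChange ℚ).conductorNorm ℤ : ℕ) : ℝ) with hN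
    have hN0 : 0 < N := by linarith
    have h1 : N ^ κ ≤ B * N ^ (6 + ε) := by
      refine hlo.trans (hSz.trans ?_)
      exact mul_le_mul_of_nonneg_right (le_max_left _ _) (Real.rpow_nonneg hN0.le _)
    have h2 : N ^ κ = N ^ (6 + ε) * N ^ γ := by
      rw [← Real.rpow_add hN0]; congr 1; rw [hγ]; ring
    have h3 : N ^ γ ≤ B := by
      rw [h2, mul_comm] at h1
      exact le_of_mul_le_mul_right h1 (Real.rpow_pos_of_pos hN0 _)
    calc N = (N ^ γ) ^ (1 / γ) := by
          rw [one_div, Real.rpow_rpow_inv hN0.le hγ0.ne']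
      _ ≤ B ^ (1 / γ) := Real.rpow_le_rpow (Real.rpow_nonneg hN0.le _) h3 (by positivity)
  refine ⟨κ, 0, (windowCount κ σ N₁ : ℝ), by rw [hκ]; linarith, by rw [hκ]; linarith, ?_, fun X _ => ?_⟩
  · exact div_pos (by rw [hκ]; linarith) (by linarith)
  · rw [Real.rpow_zero, mul_one]
    have hsub : windowSet κ σ X ⊆ windowSet κ σ N₁ := fun W hW => mem_windowSet_of_conductor_le hW (key X W hW)
    exact_mod_cast Set.ncard_le_ncard hsub (windowSet_finite _ _ _)

open Literature.NumberTheory.EllipticCurves in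
/-- **`ABC → ModerateWindowCount`**: the crux as typed is implied by the summit (and, by the route's
`Assembly`/`TwistAmplificationLemma`, implies it). -/
theorem moderateWindowCount_of_abc (h : _root_.ABC) : ModerateWindowCount := by
  apply moderateWindowCount_of_generalizedSzpiroBG
  apply abcLe_iff_generalizedSzpiroBG_holds.mp
  intro ε hε
  obtain ⟨C, -, hC⟩ := (ABC_iff.mp h) ε hε
  exact ⟨C, fun a b c ht => (hC a b c ht).le⟩

/-! ## 4. `6 < σ` is SHARP: at `σ = 6` the conclusion fails for every `κ ∈ (3, 6)` and `δ < (6−κ)/6`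

### The family (twist amplification on `1 + (p^j − 1) = p^j`)
Fix an odd prime `p` and `j = 4i`, put `q = p^j = 16k + 1`. For a prime `d ≥ 5`, `d ≠ p`, `d ∤ k`, let
`D = ±d ≡ 3 (mod 4)`, `A = D`, `B = D(q − 1) = 16Dk`, so `A + B = Dq`: the Frey curve `y² = x(x − A)(x + B)`
is the quadratic twist by `D` of the Frey curve of the triple `(1, q − 1, q)`. Its Serre-normalised model
(B–G (12.18)) `⟨1, (B−A−1)/4, 0, −AB/16, 0⟩`, translated by `[1, r, 0, t]` to a REDUCED model `tf α k`
(`α = (D+1)/4`), has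
`c₄ = D² m`, `m = 256k² + 16k + 1 = 16kq + 1 = q² − q + 1`; `Δ = D⁶ k² q²`; `c₆ = −D³(16k−1)(8k+1)(32k+1)`.
It is minimal at every prime (a prime dividing both `Δ` and `c₄` is `d`, and `d¹² ∤ Δ`), and its
conductor is EXACTLY `N = d² · p · rad k` (`f_d = 2`: additive, `d ≥ 5`; `f_p = 1`, `f_ℓ = 1` for `ℓ ∣ k`:
multiplicative; `f_ℓ = 0` otherwise — all from `SzpiroLocalDataProofs`). So with `r₀ := p · rad k`
(`p ≤ r₀ ≤ pk < p^{j+1}`, NOT a certified function of `p` — and it need not be):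
`N = r₀ d²`, `M⁺ = max |Δ| |c₄|³ = d⁶ m³`, `q⁶/8 ≤ m³ ≤ q⁶`.

### The count (uniform in the unknown `ρ = log r₀ ∈ [log p, (j+1) log p]`)
At `σ = 6` the window conditions for `tf α k` read `d ≤ U := (m³/r₀^κ)^{1/(2κ−6)}` (lower) and
`d ≥ L := √m / r₀` (upper), conductor `≤ X := r₀ U²`. We use the slightly smaller
`U := (q⁶/(8 r₀^κ))^{1/(2κ−6)}`. In logarithms (`P = log p`): `log U ≥ aP − c₀`,
`a = (6j − κ(j+1))/(2κ−6)`, `log U − log L ≥ bP − c₀`, `b = (6−κ)(j−1)/(2κ−6)`, `c₀ = log 8/(2κ−6)`, and the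
`≍ U/log U` admissible primes `d ∈ (L, U]` (Chebyshev) give
`T_[κ,6](X) ≥ U/(8 log U) − 1 − 2jP` against `C X^δ = C r₀^δ U^{2δ}`; the deficit exponent is
`(1−2δ) log U − δρ ≥ γP − c₀` with `γ = a(1−2δ) − (j+1)δ`, which is positive iff
`δ < e_j := ((6−κ)j − κ)/(6(j−1)) = (6−κ)/6 − (κ−3)/(3(j−1))`. Since `e_j ↑ (6−κ)/6`, for every
`δ < (6−κ)/6` some `j = 4i` works, and then every large prime `p` contradicts the law. The worst case of
the bookkeeping is `ρ = (j+1)P` (nearly squarefree `k`), where the count exponent is exactly the route's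
threshold `(σ−κ)/(2σ−6)` at `σ = 6j/(j+1)`; smaller `ρ` only helps. This is the route's own
TwistAmplificationLemma run as a disproof on the unconditional quality-`≥ 1` triples `(1, p^j − 1, p^j)`
(generalized Szpiro ratio `≥ 6j/(j+1)` w.r.t. `c₄³`), i.e. Szpiro's `6` is attained in the counting sense. -/

/-! ### 4.1 The polynomial model and its invariants -/

/-- `[1, r, 0, t] • ⟨1, 4β − α, 0, −(4α−1)β, 0⟩` written out: the general `u = 1`, `s = 0` translate of
B–G's model (12.18) of `y² = x(x − A)(x + B)` with `A = 4α − 1`, `B = 16β`. -/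
def fm (α β r t : ℤ) : WeierstrassCurve ℤ :=
  ⟨1, 4 * β - α + 3 * r, r + 2 * t,
    -((4 * α - 1) * β) + 2 * r * (4 * β - α) - t + 3 * r ^ 2,
    -(r * ((4 * α - 1) * β)) + r ^ 2 * (4 * β - α) + r ^ 3 - t ^ 2 - r * t⟩

theorem fm_c₄ (α β r t : ℤ) :
    (fm α β r t).c₄ = (4 * α - 1) ^ 2 + (4 * α - 1) * (16 * β) + (16 * β) ^ 2 := by
  simp only [fm, WeierstrassCurve.c₄, WeierstrassCurve.b₂, WeierstrassCurve.b₄]; ring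

theorem fm_c₆ (α β r t : ℤ) :
    (fm α β r t).c₆ = -((16 * β - (4 * α - 1)) * ((4 * α - 1) + 8 * β) * ((4 * α - 1) + 32 * β)) := by
  simp only [fm, WeierstrassCurve.c₆, WeierstrassCurve.b₂, WeierstrassCurve.b₄, WeierstrassCurve.b₆]; ring

theorem fm_Δ (α β r t : ℤ) :
    (fm α β r t).Δ = ((4 * α - 1) * β) ^ 2 * ((4 * α - 1) + 16 * β) ^ 2 := by
  simp only [fm, WeierstrassCurve.Δ, WeierstrassCurve.b₂, WeierstrassCurve.b₄, WeierstrassCurve.b₆,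
    WeierstrassCurve.b₈]; ring

/-- Reduction parameters: `r` with `a₂ + 3r ∈ {−1,0,1}`, then `t` with `r + 2t ∈ {0,1}`. -/
def redR (a : ℤ) : ℤ := -((a + 1) / 3)

def redT (r : ℤ) : ℤ := -(r / 2)

theorem red_a₂ (a : ℤ) : a + 3 * redR a = -1 ∨ a + 3 * redR a = 0 ∨ a + 3 * redR a = 1 := by
  unfold redR; omega

theorem red_a₃ (r : ℤ) : r + 2 * redT r = 0 ∨ r + 2 * redT r = 1 := by
  unfold redT; omega

/-- **The family.** `tf α k`: reduced minimal model of the twist by `D = 4α − 1` of the Frey curve of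
`1 + 16k = q` (so `β = Dk`, `B = 16Dk = D(q−1)`). -/
def tf (α k : ℤ) : WeierstrassCurve ℤ :=
  fm α ((4 * α - 1) * k) (redR (4 * ((4 * α - 1) * k) - α))
    (redT (redR (4 * ((4 * α - 1) * k) - α)))

theorem tf_a₁ (α k : ℤ) : (tf α k).a₁ = 1 := rfl

theorem tf_a₂_mem (α k : ℤ) : (tf α k).a₂ = -1 ∨ (tf α k).a₂ = 0 ∨ (tf α k).a₂ = 1 :=
  red_a₂ _

theorem tf_a₃_mem (α k : ℤ) : (tf α k).a₃ = 0 ∨ (tf α k).a₃ = 1 :=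
  red_a₃ _

theorem tf_c₄ (α k : ℤ) : (tf α k).c₄ = (4 * α - 1) ^ 2 * (256 * k ^ 2 + 16 * k + 1) := by
  rw [tf, fm_c₄]; ring

theorem tf_Δ (α k : ℤ) : (tf α k).Δ = (4 * α - 1) ^ 6 * k ^ 2 * (16 * k + 1) ^ 2 := by
  rw [tf, fm_Δ]; ring

theorem tf_c₆ (α k : ℤ) :
    (tf α k).c₆ = -((4 * α - 1) ^ 3 * (16 * k - 1) * (8 * k + 1) * (32 * k + 1)) := by
  rw [tf, fm_c₆]; ring

/-! ### 4.2 Arithmetic of the family: ellipticity, minimality, exact conductor -/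

section Arithmetic

variable {p j k d : ℕ} {α : ℤ}

/-- `m = 256k² + 16k + 1 = 16k(16k+1) + 1` is prime to `16k(16k+1)`. -/
theorem not_dvd_m_of_dvd_kq {ℓ : ℕ} (hℓ : ℓ.Prime) (h : (ℓ : ℤ) ∣ 16 * (k : ℤ) * (16 * k + 1)) :
    ¬ (ℓ : ℤ) ∣ 256 * (k : ℤ) ^ 2 + 16 * k + 1 := by
  intro hm
  have h1 : (ℓ : ℤ) ∣ 1 := by
    have e : (1 : ℤ) = (256 * (k : ℤ) ^ 2 + 16 * k + 1) - 16 * (k : ℤ) * (16 * k + 1) := by ring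
    rw [e]; exact dvd_sub hm h
  have : (ℓ : ℤ) ∣ ((1 : ℕ) : ℤ) := by simpa using h1
  have := Int.natCast_dvd_natCast.mp this
  exact hℓ.one_lt.ne' (Nat.dvd_one.mp this)

theorem D_sq (hα : 4 * α - 1 = d ∨ 4 * α - 1 = -(d : ℤ)) : (4 * α - 1) ^ 2 = (d : ℤ) ^ 2 := by
  rcases hα with h | h
  · rw [h]
  · rw [h]; ring

theorem D_pow_six (hα : 4 * α - 1 = d ∨ 4 * α - 1 = -(d : ℤ)) : (4 * α - 1) ^ 6 = (d : ℤ) ^ 6 := by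
  rcases hα with h | h
  · rw [h]
  · rw [h]; ring

theorem natAbs_D_pow_three (hα : 4 * α - 1 = d ∨ 4 * α - 1 = -(d : ℤ)) :
    ((4 * α - 1) ^ 3).natAbs = d ^ 3 := by
  rw [Int.natAbs_pow]
  rcases hα with h | h <;> (rw [h]; simp)

theorem d_dvd_D (hα : 4 * α - 1 = d ∨ 4 * α - 1 = -(d : ℤ)) : (d : ℤ) ∣ 4 * α - 1 := by
  rcases hα with h | h <;> rw [h]
  exact (dvd_neg).mpr dvd_rfl

theorem D_ne_zero (hd : d.Prime) (hα : 4 * α - 1 = d ∨ 4 * α - 1 = -(d : ℤ)) : 4 * α - 1 ≠ 0 := by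
  have : (d : ℤ) ≠ 0 := by exact_mod_cast hd.ne_zero
  rcases hα with h | h <;> rw [h]
  · exact this
  · exact neg_ne_zero.mpr this

theorem eq_d_of_prime_dvd_D (hd : d.Prime) (hα : 4 * α - 1 = d ∨ 4 * α - 1 = -(d : ℤ)) {ℓ : ℕ}
    (hℓ : ℓ.Prime) (h : (ℓ : ℤ) ∣ 4 * α - 1) : ℓ = d := by
  have h' : (ℓ : ℤ) ∣ (d : ℤ) := by
    rcases hα with e | e
    · rwa [e] at h
    · rw [e] at h; exact (dvd_neg).mp h
  exact (Nat.prime_dvd_prime_iff_eq hℓ hd).mp (Int.natCast_dvd_natCast.mp h')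

/-- **Key coprimality.** A prime dividing both `Δ (tf α k) = D⁶ k² q²` and `c₄ (tf α k) = D² m` is `d`. -/
theorem eq_d_of_dvd_Δ_of_dvd_c₄ (hd : d.Prime) (hα : 4 * α - 1 = d ∨ 4 * α - 1 = -(d : ℤ)) {ℓ : ℕ}
    (hℓ : ℓ.Prime) (hΔ : (ℓ : ℤ) ∣ (tf α (k : ℤ)).Δ) (hc₄ : (ℓ : ℤ) ∣ (tf α (k : ℤ)).c₄) : ℓ = d := by
  have hℓZ : Prime (ℓ : ℤ) := Nat.prime_iff_prime_int.mp hℓ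
  rw [tf_c₄] at hc₄
  rw [tf_Δ] at hΔ
  rcases hℓZ.dvd_or_dvd hc₄ with h | h
  · exact eq_d_of_prime_dvd_D hd hα hℓ (hℓZ.dvd_of_dvd_pow h)
  · rcases hℓZ.dvd_or_dvd hΔ with h1 | h1
    · rcases hℓZ.dvd_or_dvd h1 with h2 | h2
      · exact eq_d_of_prime_dvd_D hd hα hℓ (hℓZ.dvd_of_dvd_pow h2)
      · exact absurd h (not_dvd_m_of_dvd_kq hℓ
          (dvd_mul_of_dvd_left (dvd_mul_of_dvd_right (hℓZ.dvd_of_dvd_pow h2) _) _))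
    · exact absurd h (not_dvd_m_of_dvd_kq hℓ (dvd_mul_of_dvd_right (hℓZ.dvd_of_dvd_pow h1) _))

/-- `d¹² ∤ Δ (tf α k)` when `d ∤ k` and `d ≠ p` (`q = p^j`). -/
theorem not_d_pow_twelve_dvd_Δ (hp : p.Prime) (hq : (p : ℤ) ^ j = 16 * k + 1)
    (hd : d.Prime) (hdp : d ≠ p) (hdk : ¬ d ∣ k) (hα : 4 * α - 1 = d ∨ 4 * α - 1 = -(d : ℤ)) :
    ¬ ((d : ℕ) : ℤ) ^ 12 ∣ (tf α (k : ℤ)).Δ := by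
  rw [tf_Δ, D_pow_six hα, ← hq]
  intro h
  have hdZ : Prime (d : ℤ) := Nat.prime_iff_prime_int.mp hd
  have h' : (d : ℤ) ^ 6 * (d : ℤ) ^ 6 ∣ (d : ℤ) ^ 6 * ((k : ℤ) ^ 2 * ((p : ℤ) ^ j) ^ 2) := by
    have e1 : (d : ℤ) ^ 12 = (d : ℤ) ^ 6 * (d : ℤ) ^ 6 := by ring
    have e2 : (d : ℤ) ^ 6 * (k : ℤ) ^ 2 * ((p : ℤ) ^ j) ^ 2 = (d : ℤ) ^ 6 * ((k : ℤ) ^ 2 * ((p : ℤ) ^ j) ^ 2) := by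
      ring
    rwa [e1, e2] at h
  have hd0 : (d : ℤ) ^ 6 ≠ 0 := pow_ne_zero _ (by exact_mod_cast hd.ne_zero)
  have h6 : (d : ℤ) ^ 6 ∣ (k : ℤ) ^ 2 * ((p : ℤ) ^ j) ^ 2 := (mul_dvd_mul_iff_left hd0).mp h'
  have h1 : (d : ℤ) ∣ (k : ℤ) ^ 2 * ((p : ℤ) ^ j) ^ 2 := dvd_trans (dvd_pow_self _ (by norm_num)) h6
  rcases hdZ.dvd_or_dvd h1 with h2 | h2
  · exact hdk (Int.natCast_dvd_natCast.mp (hdZ.dvd_of_dvd_pow h2))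
  · have h3 : (d : ℤ) ∣ (p : ℤ) := hdZ.dvd_of_dvd_pow (hdZ.dvd_of_dvd_pow h2)
    exact hdp ((Nat.prime_dvd_prime_iff_eq hd hp).mp (Int.natCast_dvd_natCast.mp h3))

theorem tf_Δ_ne_zero (hk : k ≠ 0) (hd : d.Prime) (hα : 4 * α - 1 = d ∨ 4 * α - 1 = -(d : ℤ)) :
    (tf α (k : ℤ)).Δ ≠ 0 := by
  rw [tf_Δ]
  have h1 := D_ne_zero hd hα
  have h2 : (k : ℤ) ≠ 0 := by exact_mod_cast hk
  have h3 : (16 * (k : ℤ) + 1) ≠ 0 := by positivity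
  positivity

theorem tf_isElliptic (hk : k ≠ 0) (hd : d.Prime) (hα : 4 * α - 1 = d ∨ 4 * α - 1 = -(d : ℤ)) :
    ((tf α (k : ℤ)).baseChange ℚ).IsElliptic :=
  ⟨by rw [baseChange_int_Δ, isUnit_iff_ne_zero]; exact_mod_cast tf_Δ_ne_zero hk hd hα⟩

/-- **Minimality at every place.** -/
theorem tf_isMinimalAt (hp : p.Prime) (hq : (p : ℤ) ^ j = 16 * k + 1)
    (hd : d.Prime) (hdp : d ≠ p) (hdk : ¬ d ∣ k) (hα : 4 * α - 1 = d ∨ 4 * α - 1 = -(d : ℤ))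
    (v : HeightOneSpectrum ℤ) : ((tf α (k : ℤ)).baseChange ℚ).IsMinimalAt v := by
  set ℓ := Rat.HeightOneSpectrum.natGenerator v with hℓ
  have hℓp : ℓ.Prime := Rat.HeightOneSpectrum.prime_natGenerator v
  by_cases h1 : (ℓ : ℤ) ∣ (tf α (k : ℤ)).c₄
  · by_cases h2 : (ℓ : ℤ) ∣ (tf α (k : ℤ)).Δ
    · have hℓd : ℓ = d := eq_d_of_dvd_Δ_of_dvd_c₄ hd hα hℓp h2 h1
      apply isMinimalAt_baseChange_int_of_not_pow_dvd_Δ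
      rw [← hℓ, hℓd]
      exact not_d_pow_twelve_dvd_Δ hp hq hd hdp hdk hα
    · apply isMinimalAt_baseChange_int_of_not_pow_dvd_Δ
      rw [← hℓ]
      exact fun h => h2 (dvd_trans (dvd_pow_self _ (by norm_num)) h)
  · exact isMinimalAt_baseChange_int_of_not_dvd_c₄ (by rwa [← hℓ])

/-- The local conductor exponents of `tf α k`: `2` at `d`, `1` at `p` and at the primes of `k`,
`0` elsewhere. -/
theorem tf_conductorExponent (hp : p.Prime) (hj : j ≠ 0) (hq : (p : ℤ) ^ j = 16 * k + 1) (hk : k ≠ 0)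
    (hd : d.Prime) (h5 : 5 ≤ d) (hdp : d ≠ p) (hdk : ¬ d ∣ k) (hα : 4 * α - 1 = d ∨ 4 * α - 1 = -(d : ℤ))
    (ℓ : Nat.Primes) :
    haveI := tf_isElliptic hk hd hα
    ((tf α (k : ℤ)).baseChange ℚ).conductorExponent ((Rat.HeightOneSpectrum.primesEquiv (R := ℤ)).symm ℓ) =
      if (ℓ : ℕ) = d then 2 else if (ℓ : ℕ) = p then 1 else if (ℓ : ℕ) ∣ k then 1 else 0 := by
  haveI := tf_isElliptic hk hd hα
  set v := (Rat.HeightOneSpectrum.primesEquiv (R := ℤ)).symm ℓ with hv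
  have hgen : Rat.HeightOneSpectrum.natGenerator v = ℓ :=
    Literature.NumberTheory.EllipticCurves.Rat.natGenerator_primesEquiv_symm ℓ
  have hℓp : (ℓ : ℕ).Prime := ℓ.2
  have hℓZ : Prime ((ℓ : ℕ) : ℤ) := Nat.prime_iff_prime_int.mp hℓp
  have hmin := tf_isMinimalAt hp hq hd hdp hdk hα v
  have hΔ : (tf α (k : ℤ)).Δ = (4 * α - 1) ^ 6 * (k : ℤ) ^ 2 * ((p : ℤ) ^ j) ^ 2 := by rw [tf_Δ, hq]
  split_ifs with h_d h_p h_k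
  · -- `ℓ = d`: additive, `f = 2`
    refine le_antisymm ?_ ?_
    · exact conductorExponent_le_two_of_five_le_natGenerator_holds _ v (by rw [hgen, h_d]; exact h5)
    · apply two_le_conductorExponent_of_dvd_Δ_of_dvd_c₄ hmin
      · rw [hgen, h_d, tf_Δ]
        exact dvd_mul_of_dvd_left (dvd_mul_of_dvd_left (dvd_pow (d_dvd_D hα) (by norm_num)) _) _
      · rw [hgen, h_d, tf_c₄]
        exact dvd_mul_of_dvd_left (dvd_pow (d_dvd_D hα) (by norm_num)) _
  · -- `ℓ = p`: multiplicative
    apply conductorExponent_eq_one_of_dvd_Δ_of_not_dvd_c₄ hmin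
    · rw [hgen, h_p, hΔ]
      exact dvd_mul_of_dvd_right (dvd_pow (dvd_pow_self _ hj) (by norm_num)) _
    · rw [hgen]
      intro hc
      have hΔ' : ((ℓ : ℕ) : ℤ) ∣ (tf α (k : ℤ)).Δ := by
        rw [h_p, hΔ]; exact dvd_mul_of_dvd_right (dvd_pow (dvd_pow_self _ hj) (by norm_num)) _
      exact hdp ((eq_d_of_dvd_Δ_of_dvd_c₄ hd hα hℓp hΔ' hc).symm.trans h_p)
  · -- `ℓ ∣ k`, `ℓ ≠ d`: multiplicative
    apply conductorExponent_eq_one_of_dvd_Δ_of_not_dvd_c₄ hmin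
    · rw [hgen, tf_Δ]
      exact dvd_mul_of_dvd_left (dvd_mul_of_dvd_right
        (dvd_pow (Int.natCast_dvd_natCast.mpr h_k) (by norm_num)) _) _
    · rw [hgen]
      intro hc
      have hΔ' : ((ℓ : ℕ) : ℤ) ∣ (tf α (k : ℤ)).Δ := by
        rw [tf_Δ]
        exact dvd_mul_of_dvd_left (dvd_mul_of_dvd_right
          (dvd_pow (Int.natCast_dvd_natCast.mpr h_k) (by norm_num)) _) _
      exact h_d (eq_d_of_dvd_Δ_of_dvd_c₄ hd hα hℓp hΔ' hc)
  · -- good reduction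
    apply conductorExponent_eq_zero_of_not_dvd_Δ hmin
    rw [hgen, hΔ]
    intro h
    rcases hℓZ.dvd_or_dvd h with h1 | h1
    · rcases hℓZ.dvd_or_dvd h1 with h2 | h2
      · exact h_d (eq_d_of_prime_dvd_D hd hα hℓp (hℓZ.dvd_of_dvd_pow h2))
      · exact h_k (Int.natCast_dvd_natCast.mp (hℓZ.dvd_of_dvd_pow h2))
    · have : ((ℓ : ℕ) : ℤ) ∣ (p : ℤ) := hℓZ.dvd_of_dvd_pow (hℓZ.dvd_of_dvd_pow h1)
      exact h_p ((Nat.prime_dvd_prime_iff_eq hℓp hp).mp (Int.natCast_dvd_natCast.mp this))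

/-- `p ∤ k` (as `p ∣ 16k + 1`). -/
theorem not_p_dvd_k (hp : p.Prime) (hj : j ≠ 0) (hq : (p : ℤ) ^ j = 16 * k + 1) : ¬ p ∣ k := by
  intro h
  have h1 : (p : ℤ) ∣ 16 * k + 1 := by rw [← hq]; exact dvd_pow_self _ hj
  have h2 : (p : ℤ) ∣ 16 * (k : ℤ) := dvd_mul_of_dvd_right (Int.natCast_dvd_natCast.mpr h) _
  have h3 : (p : ℤ) ∣ 1 := by
    have e : (1 : ℤ) = (16 * k + 1) - 16 * k := by ring
    rw [e]; exact dvd_sub h1 h2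
  have : (p : ℤ) ∣ ((1 : ℕ) : ℤ) := by simpa using h3
  exact hp.one_lt.ne' (Nat.dvd_one.mp (Int.natCast_dvd_natCast.mp this))

/-- **The conductor of `tf α k` is exactly `d² · p · rad k`.** -/
theorem tf_conductorNorm (hp : p.Prime) (hj : j ≠ 0) (hq : (p : ℤ) ^ j = 16 * k + 1) (hk : k ≠ 0)
    (hd : d.Prime) (h5 : 5 ≤ d) (hdp : d ≠ p) (hdk : ¬ d ∣ k) (hα : 4 * α - 1 = d ∨ 4 * α - 1 = -(d : ℤ)) :
    haveI := tf_isElliptic hk hd hα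
    ((tf α (k : ℤ)).baseChange ℚ).conductorNorm ℤ = d ^ 2 * (p * UniqueFactorizationMonoid.radical k) := by
  haveI := tf_isElliptic hk hd hα
  have hN0 : ((tf α (k : ℤ)).baseChange ℚ).conductorNorm ℤ ≠ 0 := (conductorNorm_pos_holds _).ne'
  have hrad0 : UniqueFactorizationMonoid.radical k ≠ 0 := UniqueFactorizationMonoid.radical_ne_zero
  have hB0 : d ^ 2 * (p * UniqueFactorizationMonoid.radical k) ≠ 0 :=
    mul_ne_zero (pow_ne_zero _ hd.ne_zero) (mul_ne_zero hp.ne_zero hrad0)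
  have hpk := not_p_dvd_k hp hj hq
  apply Nat.eq_of_factorization_eq hN0 hB0
  intro ℓ
  by_cases hℓ : ℓ.Prime
  · rw [factorization_conductorNorm_primesEquiv_symm _ ⟨ℓ, hℓ⟩,
      tf_conductorExponent hp hj hq hk hd h5 hdp hdk hα ⟨ℓ, hℓ⟩]
    simp only
    rw [Nat.factorization_mul (pow_ne_zero _ hd.ne_zero) (mul_ne_zero hp.ne_zero hrad0),
      Nat.factorization_mul hp.ne_zero hrad0, Nat.factorization_pow, hd.factorization, hp.factorization]
    simp only [Finsupp.coe_add, Pi.add_apply, Finsupp.smul_apply, Finsupp.single_apply, smul_eq_mul]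
    rw [Literature.NumberTheory.DiophantineGeometry.factorization_radical_apply hk hℓ]
    by_cases h_d : ℓ = d
    · subst h_d
      have h2 : p ≠ ℓ := fun h => hdp h.symm
      simp [h2, hdk]
    · by_cases h_p : ℓ = p
      · have h1 : d ≠ ℓ := fun h => h_d h.symm
        have hℓk : ¬ ℓ ∣ k := h_p ▸ hpk
        simp [h_d, h1, h_p.symm, hℓk]
      · have h1 : d ≠ ℓ := fun h => h_d h.symm
        have h2 : p ≠ ℓ := fun h => h_p h.symm
        by_cases h_k : ℓ ∣ k
        · simp [h1, h2, h_k, h_d, h_p]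
        · simp [h1, h2, h_k, h_d, h_p]
  · rw [Nat.factorization_eq_zero_of_not_prime _ hℓ, Nat.factorization_eq_zero_of_not_prime _ hℓ]

end Arithmetic

/-! ### 4.3 Window membership (log form) and the labelling `αOf` -/

section Membership

variable {p j k d : ℕ} {α : ℤ}

/-- `m = 256k² + 16k + 1 = q² − q + 1`. -/
def mOf (k : ℕ) : ℕ := 256 * k ^ 2 + 16 * k + 1

theorem mOf_cast (k : ℕ) : ((mOf k : ℕ) : ℤ) = 256 * (k : ℤ) ^ 2 + 16 * k + 1 := by
  simp [mOf]

theorem mOf_pos (k : ℕ) : 0 < mOf k := by unfold mOf; positivity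

/-- `M⁺ (tf α k) = d⁶ m³` (the `c₄³` term dominates). -/
theorem tf_maxInv (hα : 4 * α - 1 = d ∨ 4 * α - 1 = -(d : ℤ)) :
    max |(tf α (k : ℤ)).Δ| (|(tf α (k : ℤ)).c₄| ^ 3) = (d : ℤ) ^ 6 * ((mOf k : ℕ) : ℤ) ^ 3 := by
  rw [tf_Δ, tf_c₄, D_pow_six hα, D_sq hα, mOf_cast]
  set m' : ℤ := 256 * (k : ℤ) ^ 2 + 16 * k + 1 with hm'
  have hm'1 : 1 ≤ m' := by
    have : (0 : ℤ) ≤ 256 * (k : ℤ) ^ 2 + 16 * k := by positivity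
    rw [hm']; linarith
  have hk0 : (0 : ℤ) ≤ k := by positivity
  have hd0 : (0 : ℤ) ≤ (d : ℤ) ^ 6 := by positivity
  have hc : |(d : ℤ) ^ 2 * m'| ^ 3 = (d : ℤ) ^ 6 * m' ^ 3 := by
    rw [abs_of_nonneg (by positivity)]; ring
  have hΔ : |(d : ℤ) ^ 6 * (k : ℤ) ^ 2 * (16 * k + 1) ^ 2| = (d : ℤ) ^ 6 * ((k : ℤ) * (16 * k + 1)) ^ 2 := by
    rw [abs_of_nonneg (by positivity)]; ring
  rw [hc, hΔ]
  apply max_eq_right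
  apply mul_le_mul_of_nonneg_left _ hd0
  have h1 : (k : ℤ) * (16 * k + 1) ≤ m' := by rw [hm']; nlinarith
  have h2 : (0 : ℤ) ≤ (k : ℤ) * (16 * k + 1) := by positivity
  calc ((k : ℤ) * (16 * k + 1)) ^ 2 ≤ m' ^ 2 := pow_le_pow_left₀ h2 h1 2
    _ ≤ m' ^ 3 := pow_le_pow_right₀ hm'1 (by norm_num)

theorem tf_c₄_ne_zero (hd : d.Prime) (hα : 4 * α - 1 = d ∨ 4 * α - 1 = -(d : ℤ)) :
    (tf α (k : ℤ)).c₄ ≠ 0 := by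
  rw [tf_c₄]
  have h1 := D_ne_zero hd hα
  have h2 : (256 * (k : ℤ) ^ 2 + 16 * k + 1) ≠ 0 := by positivity
  positivity

theorem tf_c₆_ne_zero (hk : k ≠ 0) (hd : d.Prime) (hα : 4 * α - 1 = d ∨ 4 * α - 1 = -(d : ℤ)) :
    (tf α (k : ℤ)).c₆ ≠ 0 := by
  rw [tf_c₆, neg_ne_zero]
  have h1 := D_ne_zero hd hα
  have hk1 : (1 : ℤ) ≤ k := by exact_mod_cast Nat.one_le_iff_ne_zero.mpr hk
  have h2 : (16 * (k : ℤ) - 1) ≠ 0 := by omega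
  have h3 : (8 * (k : ℤ) + 1) ≠ 0 := by omega
  have h4 : (32 * (k : ℤ) + 1) ≠ 0 := by omega
  exact mul_ne_zero (mul_ne_zero (mul_ne_zero (pow_ne_zero _ h1) h2) h3) h4

/-- **Membership of `tf α k` in the window `[κ, σ]` at scale `X`**, with the two ratio conditions in
logarithmic form (`N = d² r₀`, `r₀ = p · rad k`, `M⁺ = d⁶ m³`). -/
theorem tf_mem_window {κ σ : ℝ} (hp : p.Prime) (hj : j ≠ 0) (hq : (p : ℤ) ^ j = 16 * k + 1)
    (hk : k ≠ 0) (hd : d.Prime) (h5 : 5 ≤ d) (hdp : d ≠ p) (hdk : ¬ d ∣ k)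
    (hα : 4 * α - 1 = d ∨ 4 * α - 1 = -(d : ℤ)) {X : ℝ}
    (hNX : (d : ℝ) ^ 2 * ((p * UniqueFactorizationMonoid.radical k : ℕ) : ℝ) ≤ X)
    (hlo : κ * Real.log ((d : ℝ) ^ 2 * ((p * UniqueFactorizationMonoid.radical k : ℕ) : ℝ)) ≤
      Real.log ((d : ℝ) ^ 6 * ((mOf k : ℕ) : ℝ) ^ 3))
    (hhi : Real.log ((d : ℝ) ^ 6 * ((mOf k : ℕ) : ℝ) ^ 3) ≤
      σ * Real.log ((d : ℝ) ^ 2 * ((p * UniqueFactorizationMonoid.radical k : ℕ) : ℝ))) :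
    tf α (k : ℤ) ∈ windowSet κ σ X := by
  haveI hE := tf_isElliptic hk hd hα
  have hN : ((((tf α (k : ℤ)).baseChange ℚ).conductorNorm ℤ : ℕ) : ℝ) =
      (d : ℝ) ^ 2 * ((p * UniqueFactorizationMonoid.radical k : ℕ) : ℝ) := by
    rw [tf_conductorNorm hp hj hq hk hd h5 hdp hdk hα]; push_cast; ring
  have hM : (((max |(tf α (k : ℤ)).Δ| (|(tf α (k : ℤ)).c₄| ^ 3) : ℤ) : ℝ)) =
      (d : ℝ) ^ 6 * ((mOf k : ℕ) : ℝ) ^ 3 := by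
    rw [tf_maxInv hα]; push_cast; ring
  have hd0 : (0 : ℝ) < d := by exact_mod_cast hd.pos
  have hr0 : (0 : ℝ) < ((p * UniqueFactorizationMonoid.radical k : ℕ) : ℝ) := by
    have : 0 < p * UniqueFactorizationMonoid.radical k := Nat.mul_pos hp.pos (Nat.radical_pos _)
    exact_mod_cast this
  have hB0 : (0 : ℝ) < (d : ℝ) ^ 2 * ((p * UniqueFactorizationMonoid.radical k : ℕ) : ℝ) := by positivity
  have hm0 : (0 : ℝ) < ((mOf k : ℕ) : ℝ) := by exact_mod_cast mOf_pos k
  have hM0 : (0 : ℝ) < (d : ℝ) ^ 6 * ((mOf k : ℕ) : ℝ) ^ 3 := by positivity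
  refine ⟨hE, tf_isMinimalAt hp hq hd hdp hdk hα, Or.inr (tf_a₁ _ _), tf_a₃_mem _ _, tf_a₂_mem _ _,
    tf_c₄_ne_zero hd hα, tf_c₆_ne_zero hk hd hα, ?_, ?_, ?_⟩
  · rw [hN]; exact hNX
  · rw [hN, hM, Real.rpow_def_of_pos hB0, ← Real.exp_log hM0]
    exact Real.exp_le_exp.mpr (by linarith)
  · rw [hN, hM, Real.rpow_def_of_pos hB0, ← Real.exp_log hM0]
    exact Real.exp_le_exp.mpr (by linarith)

end Membership

/-- `αOf d`: the integer `α` with `4α − 1 = ±d`, for odd `d`. -/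
def αOf (d : ℕ) : ℤ := if d % 4 = 1 then -(((d : ℤ) - 1) / 4) else ((d : ℤ) + 1) / 4

theorem αOf_spec {d : ℕ} (hd : d % 2 = 1) : 4 * αOf d - 1 = d ∨ 4 * αOf d - 1 = -(d : ℤ) := by
  unfold αOf
  split_ifs with h <;> omega

/-- The family is injective in `d` (read off `c₄ = d² m`). -/
theorem tf_αOf_injOn (k : ℕ) : Set.InjOn (fun d => tf (αOf d) (k : ℤ)) {d : ℕ | d % 2 = 1} := by
  intro d hd d' hd' h
  have h4 : (tf (αOf d) (k : ℤ)).c₄ = (tf (αOf d') (k : ℤ)).c₄ := by simp only at h; rw [h]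
  rw [tf_c₄, tf_c₄, D_sq (αOf_spec hd), D_sq (αOf_spec hd')] at h4
  have hm : (256 * (k : ℤ) ^ 2 + 16 * k + 1) ≠ 0 := by positivity
  have h5 : (d : ℤ) ^ 2 = (d' : ℤ) ^ 2 := mul_right_cancel₀ hm h4
  have h6 : d ^ 2 = d' ^ 2 := by exact_mod_cast h5
  exact Nat.pow_left_injective (by norm_num) h6

/-! #### Preparations for the endgame: residues, exponents, complement count, `log m` -/

/-- `p` odd ⇒ `p^{4i} ≡ 1 (mod 16)`. -/
theorem pow_four_mul_mod_sixteen {p : ℕ} (hp : p % 2 = 1) (i : ℕ) : p ^ (4 * i) % 16 = 1 := by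
  have h4 : p ^ 4 % 16 = 1 := by
    have hlt : p % 16 < 16 := Nat.mod_lt _ (by norm_num)
    have hodd : p % 16 % 2 = 1 := by rw [Nat.mod_mod_of_dvd _ (by norm_num)]; exact hp
    rw [Nat.pow_mod]
    interval_cases (p % 16) <;> simp_all
  rw [pow_mul, Nat.pow_mod, h4]; simp

/-- **Exponent bookkeeping.** For `κ ∈ (3,6)` and `0 ≤ δ < (6−κ)/6` there is `j = 4i` with
`(6−κ) j > κ` and `6δ(j−1) < (6−κ)j − κ` (i.e. `δ < e_j = ((6−κ)j − κ)/(6(j−1))`, equivalently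
`(κ−3)/(3(j−1)) < (6−κ)/6 − δ`): then `a = (6j − κ(j+1))/(2κ−6) > 0` and
`γ = a(1−2δ) − (j+1)δ > 0`. -/
theorem sixSharp_exponents {κ δ : ℝ} (hκ3 : 3 < κ) (hδ0 : 0 ≤ δ) (hδ : δ < (6 - κ) / 6) :
    ∃ i : ℕ, 1 ≤ i ∧ 0 < 6 * ((4 * i : ℕ) : ℝ) - κ * (((4 * i : ℕ) : ℝ) + 1) ∧
      0 < (6 * ((4 * i : ℕ) : ℝ) - κ * (((4 * i : ℕ) : ℝ) + 1)) / (2 * κ - 6) * (1 - 2 * δ) -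
        (((4 * i : ℕ) : ℝ) + 1) * δ := by
  set g : ℝ := (6 - κ) / 6 - δ with hgdef
  have hg : 0 < g := by rw [hgdef]; linarith
  have h26 : 0 < 2 * κ - 6 := by linarith
  obtain ⟨i, hi⟩ := exists_nat_gt ((κ - 3) / (3 * g) + 2)
  have hi1 : (1 : ℝ) ≤ i := by
    have : 0 ≤ (κ - 3) / (3 * g) := div_nonneg (by linarith) (by linarith)
    linarith
  refine ⟨i, by exact_mod_cast hi1, ?_, ?_⟩
  all_goals
    set t : ℝ := ((4 * i : ℕ) : ℝ) - 1 with htdef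
    have hjt : ((4 * i : ℕ) : ℝ) = t + 1 := by rw [htdef]; ring
    have ht : (κ - 3) < 3 * g * t := by
      have h1 : (κ - 3) / (3 * g) < t := by rw [htdef]; push_cast; linarith
      have h2 := (div_lt_iff₀ (by linarith : (0 : ℝ) < 3 * g)).mp h1
      linarith
    have ht0 : 0 < t := by rw [htdef]; push_cast; linarith
    have key : 6 * δ * t < (6 - κ) * (t + 1) - κ := by
      have e : g * t = t - κ * t / 6 - δ * t := by rw [hgdef]; ring
      linarith [e, ht]
    have hδt : 0 ≤ 6 * δ * t := by positivity
    rw [hjt]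
  · linarith [key]
  · have hnum : 0 < 6 * (t + 1) - κ * (t + 1 + 1) := by linarith [key]
    have e : (2 * κ - 6) * ((6 * (t + 1) - κ * (t + 1 + 1)) / (2 * κ - 6) * (1 - 2 * δ) -
        (t + 1 + 1) * δ) = ((6 - κ) * (t + 1) - κ) - 6 * δ * t := by
      field_simp
      ring
    have h1 : 0 < (2 * κ - 6) * ((6 * (t + 1) - κ * (t + 1 + 1)) / (2 * κ - 6) * (1 - 2 * δ) -
        (t + 1 + 1) * δ) := by rw [e]; linarith [key]
    rcases (mul_pos_iff.mp h1) with ⟨_, h2⟩ | ⟨h3, _⟩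
    · exact h2
    · linarith

/-- Complement count: the primes of `(A, V]` that are `p` or divide `k ≠ 0` are at most `ω(k) + 1`. -/
theorem card_primesIoc_le_filter_add {A V p k : ℕ} (hk : k ≠ 0) :
    (primesIoc A V).card ≤ ((primesIoc A V).filter (fun d => d ≠ p ∧ ¬ d ∣ k)).card +
      (k.primeFactors.card + 1) := by
  classical
  have h1 := Finset.card_filter_add_card_filter_not (s := primesIoc A V) (fun d => d ≠ p ∧ ¬ d ∣ k)
  have h2 : ((primesIoc A V).filter (fun d => ¬ (d ≠ p ∧ ¬ d ∣ k))).card ≤ k.primeFactors.card + 1 := by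
    refine le_trans (Finset.card_le_card ?_) (Finset.card_insert_le p k.primeFactors)
    intro d hd
    rw [Finset.mem_filter] at hd
    obtain ⟨hd1, hd2⟩ := hd
    rw [primesIoc, Finset.mem_filter] at hd1
    rw [Finset.mem_insert]
    by_cases hdp : d = p
    · exact Or.inl hdp
    · right
      have : d ∣ k := by by_contra h; exact hd2 ⟨hdp, h⟩
      exact Nat.mem_primeFactors.mpr ⟨hd1.2, this, hk⟩
  omega

/-- `q²/2 ≤ m ≤ q²` in logarithms, `q = 16k + 1`, `m = mOf k`. -/
theorem log_mOf_bounds (k : ℕ) :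
    Real.log (mOf k : ℕ) ≤ 2 * Real.log (16 * (k : ℝ) + 1) ∧
      2 * Real.log (16 * (k : ℝ) + 1) ≤ Real.log 2 + Real.log (mOf k : ℕ) := by
  have hk0 : (0 : ℝ) ≤ k := Nat.cast_nonneg k
  have hm0 : (0 : ℝ) < (mOf k : ℕ) := by exact_mod_cast mOf_pos k
  have hq0 : (0 : ℝ) < 16 * (k : ℝ) + 1 := by positivity
  constructor
  · have h1 : ((mOf k : ℕ) : ℝ) ≤ (16 * (k : ℝ) + 1) ^ 2 := by unfold mOf; push_cast; nlinarith
    have h2 := Real.log_le_log hm0 h1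
    rwa [Real.log_pow, Nat.cast_ofNat] at h2
  · have h1 : (16 * (k : ℝ) + 1) ^ 2 ≤ 2 * ((mOf k : ℕ) : ℝ) := by
      unfold mOf; push_cast; nlinarith [sq_nonneg (k : ℝ)]
    have h2 := Real.log_le_log (by positivity) h1
    rwa [Real.log_pow, Nat.cast_ofNat, Real.log_mul (by norm_num) hm0.ne'] at h2

/-! ### 4.4 The endgame, deterministic core: a large prime `p` contradicts the law on `[κ, σ]`, `σ ≤ 6` -/

set_option maxHeartbeats 1600000 in
/-- **Core of the sharpness proof.** Given the law on the window `[κ, σ]`, `3 < κ < σ ≤ 6`, with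
`0 ≤ δ < (6−κ)/6`, `1 ≤ C`, an exponent `j` with `(6−κ)j > κ`, the Chebyshev threshold `T₀`, and a prime
`p ≥ 3` with `p^j ≡ 1 (16)` satisfying the four largeness conditions (in `a = (6j−κ(j+1))/(2κ−6)`,
`b = 6(σ−κ)(j−1)/((2κ−6)(2σ−6))`, `c₀ = log 8/(2κ−6)`, `a' = 6j/(2κ−6)`, `γ = a(1−2δ) − (j+1)δ`):
contradiction. See the module docstring for the bookkeeping. -/
theorem sixSharp_core {κ σ δ C : ℝ} (hκ3 : 3 < κ) (hκσ : κ < σ) (hσ6 : σ ≤ 6) (hδ0 : 0 ≤ δ)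
    (hδ : δ < (6 - κ) / 6)
    (hC1 : 1 ≤ C) (hlaw : ∀ X : ℝ, 1 ≤ X → (windowCount κ σ X : ℝ) ≤ C * X ^ δ)
    {j : ℕ} (hj0 : j ≠ 0) (hj4 : (4 : ℝ) ≤ j) (hnum : 0 < 6 * j - κ * ((j : ℝ) + 1))
    {T₀ : ℕ} (hT₀ : ∀ A T : ℕ, T₀ ≤ T → 6 * A + 1 ≤ T →
      (T : ℝ) / 4 ≤ (primesIoc A T).card * Real.log T)
    {p : ℕ} (hp : p.Prime) (hp3 : 3 ≤ p) (hq16 : p ^ j % 16 = 1)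
    (hE1 : 2 * ((max T₀ 64 : ℕ) : ℝ) * Real.exp (Real.log 8 / (2 * κ - 6)) ≤
      (p : ℝ) ^ ((6 * j - κ * ((j : ℝ) + 1)) / (2 * κ - 6)))
    (hE2 : 12 * Real.exp (Real.log 8 / (2 * κ - 6)) ≤
      (p : ℝ) ^ (6 * (σ - κ) * ((j : ℝ) - 1) / ((2 * κ - 6) * (2 * σ - 6))))
    (hE3 : 48 * (6 * (j : ℝ) / (2 * κ - 6)) * j * Real.exp (Real.log 8 / (2 * κ - 6)) * Real.log p ^ 2 ≤
      (p : ℝ) ^ ((6 * j - κ * ((j : ℝ) + 1)) / (2 * κ - 6)))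
    (hE4 : 32 * C * (6 * (j : ℝ) / (2 * κ - 6)) * Real.exp (Real.log 8 / (2 * κ - 6)) * Real.log p ≤
      (p : ℝ) ^ ((6 * j - κ * ((j : ℝ) + 1)) / (2 * κ - 6) * (1 - 2 * δ) - ((j : ℝ) + 1) * δ)) :
    False := by
  -- names for the exponents and constants
  set a : ℝ := (6 * j - κ * ((j : ℝ) + 1)) / (2 * κ - 6) with hadef
  set a' : ℝ := 6 * (j : ℝ) / (2 * κ - 6) with ha'def
  set b : ℝ := 6 * (σ - κ) * ((j : ℝ) - 1) / ((2 * κ - 6) * (2 * σ - 6)) with hbdef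
  set c₀ : ℝ := Real.log 8 / (2 * κ - 6) with hc₀def
  set γ : ℝ := a * (1 - 2 * δ) - ((j : ℝ) + 1) * δ with hγdef
  set T₁ : ℕ := max T₀ 64 with hT₁def
  have hC0 : 0 < C := by linarith
  have h26 : 0 < 2 * κ - 6 := by linarith
  have hκ6 : κ < 6 := lt_of_lt_of_le hκσ hσ6
  have h2σ : 0 < 2 * σ - 6 := by linarith
  have hκσ26 : 0 < (2 * κ - 6) * (2 * σ - 6) := mul_pos h26 h2σ
  have hκ0 : 0 < κ := by linarith
  have h12 : (6 - κ) / 6 < 1 / 2 := by rw [div_lt_iff₀ (by norm_num)]; linarith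
  have h6δ : 0 < κ - 6 * δ := by linarith
  have h12δ : 0 < 1 - 2 * δ := by linarith
  have ha_mul : (2 * κ - 6) * a = 6 * j - κ * (j + 1) := by rw [hadef]; field_simp
  have ha'_mul : (2 * κ - 6) * a' = 6 * j := by rw [ha'def]; field_simp
  have hb_mul : (2 * κ - 6) * (2 * σ - 6) * b = 6 * (σ - κ) * (j - 1) := by rw [hbdef]; field_simp
  have hc₀_mul : (2 * κ - 6) * c₀ = Real.log 8 := by rw [hc₀def]; field_simp
  have hlog8 : Real.log 8 = 3 * Real.log 2 := by
    rw [show (8 : ℝ) = 2 ^ 3 by norm_num, Real.log_pow]; norm_num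
  have hlog2 : 0 < Real.log 2 := Real.log_pos (by norm_num)
  have ha : 0 < a := by rw [hadef]; exact div_pos hnum h26
  have ha' : 0 < a' := by rw [ha'def]; exact div_pos (by positivity) h26
  have hγ_mul : (2 * κ - 6) * γ = (6 * j - κ * (j + 1)) * (1 - 2 * δ) - (j + 1) * δ * (2 * κ - 6) := by
    rw [hγdef, mul_sub, ← mul_assoc, ha_mul]; ring
  have hp0 : (0 : ℝ) < p := by exact_mod_cast hp.pos
  ------------------------------------------------------------------
  -- `q = p^j = 16 k + 1`
  ------------------------------------------------------------------
  set k : ℕ := p ^ j / 16 with hkdef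
  have hqk : p ^ j = 16 * k + 1 := by have := Nat.div_add_mod (p ^ j) 16; omega
  have hq : (p : ℤ) ^ j = 16 * k + 1 := by exact_mod_cast hqk
  have hk : k ≠ 0 := by
    have hqge : 3 ^ 1 ≤ p ^ j :=
      (Nat.pow_le_pow_left hp3 1).trans (Nat.pow_le_pow_right hp.pos (Nat.one_le_iff_ne_zero.mpr hj0))
    intro h; rw [h] at hqk; norm_num at hqk; omega
  have hk1 : 1 ≤ k := Nat.one_le_iff_ne_zero.mpr hk
  ------------------------------------------------------------------
  -- the real bookkeeping: `P, ρ, Lm, ℓU, U, ℓL, L`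
  ------------------------------------------------------------------
  set P : ℝ := Real.log p with hPdef
  have hP1 : 1 ≤ P := by
    have h3 : Real.log 3 ≤ Real.log p := Real.log_le_log (by norm_num) (by exact_mod_cast hp3)
    have : 1 < Real.log 3 := by
      rw [Real.lt_log_iff_exp_lt (by norm_num)]; have := Real.exp_one_lt_d9; linarith
    rw [hPdef]; linarith
  set r₀ : ℕ := p * UniqueFactorizationMonoid.radical k with hr₀def
  have hr₀p : p ≤ r₀ := Nat.le_mul_of_pos_right _ (Nat.radical_pos _)
  have hr₀0 : (0 : ℝ) < r₀ := by exact_mod_cast lt_of_lt_of_le hp.pos hr₀p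
  set ρ : ℝ := Real.log r₀ with hρdef
  have hρ1 : P ≤ ρ := Real.log_le_log hp0 (by exact_mod_cast hr₀p)
  have hρ2 : ρ ≤ (j + 1) * P := by
    have h1 : (r₀ : ℝ) ≤ (p : ℝ) ^ (j + 1) := by
      have : r₀ ≤ p ^ (j + 1) :=
        calc r₀ ≤ p * k := Nat.mul_le_mul_left _ (Nat.radical_le_self_iff.mpr hk)
          _ ≤ p * p ^ j := Nat.mul_le_mul_left _ (by omega)
          _ = p ^ (j + 1) := by ring
      exact_mod_cast this
    have h2 := Real.log_le_log hr₀0 h1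
    rw [Real.log_pow] at h2; push_cast at h2; rw [hρdef, hPdef]; linarith
  have hm0 : (0 : ℝ) < (mOf k : ℕ) := by exact_mod_cast mOf_pos k
  set Lm : ℝ := Real.log (mOf k : ℕ) with hLmdef
  have hqR : ((p : ℝ) ^ j) = 16 * k + 1 := by exact_mod_cast hqk
  have hlogq : Real.log (16 * (k : ℝ) + 1) = j * P := by rw [← hqR, Real.log_pow]
  obtain ⟨hLm1, hLm2⟩ := log_mOf_bounds k
  have hLm_hi : Lm ≤ 2 * j * P := by rw [hLmdef]; rw [hlogq] at hLm1; linarith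
  have hLm_lo : 6 * j * P - Real.log 8 ≤ 3 * Lm := by rw [hLmdef, hlog8]; rw [hlogq] at hLm2; linarith
  set ℓU : ℝ := (6 * j * P - Real.log 8 - κ * ρ) / (2 * κ - 6) with hℓUdef
  have hℓU_mul : (2 * κ - 6) * ℓU = 6 * j * P - Real.log 8 - κ * ρ := by rw [hℓUdef]; field_simp
  have hℓU_lo : a * P - c₀ ≤ ℓU := by
    have e : (2 * κ - 6) * (ℓU - (a * P - c₀)) = κ * ((j + 1) * P - ρ) := by
      have : (2 * κ - 6) * (ℓU - (a * P - c₀)) =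
          (2 * κ - 6) * ℓU - ((2 * κ - 6) * a) * P + (2 * κ - 6) * c₀ := by ring
      rw [this, hℓU_mul, ha_mul, hc₀_mul]; ring
    have h1 : 0 ≤ (2 * κ - 6) * (ℓU - (a * P - c₀)) := by rw [e]; exact mul_nonneg hκ0.le (by linarith)
    have h2 := (mul_nonneg_iff_of_pos_left h26).mp h1
    linarith
  have hℓU_hi : ℓU ≤ a' * P := by
    have e : (2 * κ - 6) * (a' * P - ℓU) = κ * ρ + Real.log 8 := by
      have : (2 * κ - 6) * (a' * P - ℓU) = ((2 * κ - 6) * a') * P - (2 * κ - 6) * ℓU := by ring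
      rw [this, ha'_mul, hℓU_mul]; ring
    have hpos : 0 ≤ (2 * κ - 6) * (a' * P - ℓU) := by
      rw [e]; have : 0 ≤ ρ := le_trans (by linarith) hρ1; positivity
    have h2 := (mul_nonneg_iff_of_pos_left h26).mp hpos
    linarith
  set U : ℝ := Real.exp ℓU with hUdef
  have hU0 : 0 < U := Real.exp_pos _
  have hlogU : Real.log U = ℓU := Real.log_exp _
  have hpa : Real.exp (a * P) = (p : ℝ) ^ a := by rw [Real.rpow_def_of_pos hp0, hPdef, mul_comm]
  have hU_lo : (p : ℝ) ^ a / Real.exp c₀ ≤ U := by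
    rw [← hpa, ← Real.exp_sub, hUdef]; exact Real.exp_le_exp.mpr hℓU_lo
  have hexpc₀ : 0 < Real.exp c₀ := Real.exp_pos _
  have hU_T₁ : 2 * (T₁ : ℝ) ≤ U := by
    refine le_trans ?_ hU_lo
    rw [le_div_iff₀ hexpc₀]; exact hE1
  have hT₁64 : (64 : ℝ) ≤ T₁ := by exact_mod_cast le_max_right T₀ 64
  have hT₁T₀ : (T₀ : ℝ) ≤ T₁ := by exact_mod_cast le_max_left T₀ 64
  have hU128 : (128 : ℝ) ≤ U := by linarith
  have hℓU0 : 0 < ℓU := by rw [← hlogU]; exact Real.log_pos (by linarith)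
  have hU_E3 : 48 * a' * j * P ^ 2 ≤ U := by
    refine le_trans ?_ hU_lo
    rw [le_div_iff₀ hexpc₀]
    have e : 48 * a' * j * P ^ 2 * Real.exp c₀ = 48 * a' * j * Real.exp c₀ * P ^ 2 := by ring
    rw [e]; exact hE3
  set ℓL : ℝ := (3 * Lm - σ * ρ) / (2 * σ - 6) with hℓLdef
  have hℓL_mul : (2 * σ - 6) * ℓL = 3 * Lm - σ * ρ := by rw [hℓLdef]; field_simp
  set L : ℝ := Real.exp ℓL with hLdef
  have hL0 : 0 < L := Real.exp_pos _
  have hUL : ℓL + Real.log 12 ≤ ℓU := by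
    have E5 : (2 * κ - 6) * (2 * σ - 6) * (ℓU - ℓL) - (2 * κ - 6) * (2 * σ - 6) * (b * P - c₀) =
        3 * (2 * κ - 6) * (2 * j * P - Lm) + 6 * (σ - κ) * ((j + 1) * P - ρ) := by
      have e1 : (2 * κ - 6) * (2 * σ - 6) * (ℓU - ℓL) - (2 * κ - 6) * (2 * σ - 6) * (b * P - c₀) =
          (2 * σ - 6) * ((2 * κ - 6) * ℓU) - (2 * κ - 6) * ((2 * σ - 6) * ℓL)
            - ((2 * κ - 6) * (2 * σ - 6) * b) * P + (2 * σ - 6) * ((2 * κ - 6) * c₀) := by ring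
      rw [e1, hℓU_mul, hℓL_mul, hb_mul, hc₀_mul]; ring
    have hpos : 0 ≤ 3 * (2 * κ - 6) * (2 * j * P - Lm) + 6 * (σ - κ) * ((j + 1) * P - ρ) :=
      add_nonneg (mul_nonneg (by linarith) (by linarith)) (mul_nonneg (by linarith) (by linarith))
    have hbP : Real.log 12 + c₀ ≤ b * P := by
      have h1 : Real.log (12 * Real.exp c₀) ≤ Real.log ((p : ℝ) ^ b) :=
        Real.log_le_log (by positivity) hE2
      rw [Real.log_mul (by norm_num) hexpc₀.ne', Real.log_exp, Real.log_rpow hp0] at h1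
      rw [hPdef]; linarith
    have h3 : (2 * κ - 6) * (2 * σ - 6) * (b * P - c₀) ≤ (2 * κ - 6) * (2 * σ - 6) * (ℓU - ℓL) := by
      linarith
    have h4 : b * P - c₀ ≤ ℓU - ℓL := le_of_mul_le_mul_left h3 hκσ26
    linarith
  have hU12L : 12 * L ≤ U := by
    have : Real.exp (ℓL + Real.log 12) ≤ Real.exp ℓU := Real.exp_le_exp.mpr hUL
    rwa [Real.exp_add, Real.exp_log (by norm_num), mul_comm] at this
  -- `V = ⌊U⌋`, `A = max ⌈L⌉ 4`
  set V : ℕ := ⌊U⌋₊ with hVdef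
  have hVU : (V : ℝ) ≤ U := Nat.floor_le hU0.le
  have hUV : U < V + 1 := Nat.lt_floor_add_one U
  have hV0 : (0 : ℝ) < V := by linarith
  have hT₀V : T₀ ≤ V := Nat.le_floor (by linarith)
  set A : ℕ := max ⌈L⌉₊ 4 with hAdef
  have hAL : ⌈L⌉₊ ≤ A := le_max_left _ _
  have hAR : (A : ℝ) ≤ L + 5 := by
    have h1 : (⌈L⌉₊ : ℝ) < L + 1 := Nat.ceil_lt_add_one hL0.le
    rw [hAdef, Nat.cast_max]
    apply max_le <;> push_cast <;> linarith
  have hAV : 6 * A + 1 ≤ V := by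
    apply Nat.le_floor; push_cast; linarith [hAR, hU12L, hU128]
  ------------------------------------------------------------------
  -- the admissible twisting primes and the count
  ------------------------------------------------------------------
  set N₁ : ℝ := ((primesIoc A V).card : ℝ) with hN₁def
  have hN₁0 : 0 ≤ N₁ := Nat.cast_nonneg _
  have hlogV : Real.log V ≤ ℓU := by rw [← hlogU]; exact Real.log_le_log hV0 hVU
  have hstar : U / 8 ≤ N₁ * ℓU := by
    have h1 : (V : ℝ) / 4 ≤ N₁ * Real.log V := hT₀ A V hT₀V hAV
    have h2 : N₁ * Real.log V ≤ N₁ * ℓU := mul_le_mul_of_nonneg_left hlogV hN₁0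
    linarith
  classical
  set adm : Finset ℕ := (primesIoc A V).filter (fun d => d ≠ p ∧ ¬ d ∣ k) with hadmdef
  have hcompl : N₁ ≤ (adm.card : ℝ) + (k.primeFactors.card + 1) := by
    rw [hN₁def, hadmdef]; exact_mod_cast card_primesIoc_le_filter_add (A := A) (V := V) (p := p) hk
  have hpf : (k.primeFactors.card : ℝ) ≤ 2 * j * P := by
    -- `ω(k) log 2 ≤ log k`: `2^{ω(k)} ≤ ∏_{q ∣ k} q ≤ k`
    have h1 : (k.primeFactors.card : ℝ) * Real.log 2 ≤ Real.log k := by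
      have e1 : 2 ^ k.primeFactors.card ≤ ∏ q ∈ k.primeFactors, q :=
        Finset.pow_card_le_prod _ _ 2 (fun q hq => (Nat.prime_of_mem_primeFactors hq).two_le)
      have e2 : ∏ q ∈ k.primeFactors, q ≤ k :=
        Nat.le_of_dvd (Nat.pos_of_ne_zero hk) (Nat.prod_primeFactors_dvd k)
      have e3 : ((2 : ℕ) : ℝ) ^ k.primeFactors.card ≤ (k : ℝ) := by exact_mod_cast e1.trans e2
      have e4 : Real.log ((2 : ℝ) ^ k.primeFactors.card) ≤ Real.log k :=
        Real.log_le_log (by positivity) (by exact_mod_cast e3)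
      rwa [Real.log_pow] at e4
    have h2 : Real.log k ≤ j * P := by
      rw [← hlogq]
      exact Real.log_le_log (by exact_mod_cast hk1) (by linarith [show (0:ℝ) ≤ k from Nat.cast_nonneg k])
    have h3 := Real.log_two_gt_d9
    have h4 : (k.primeFactors.card : ℝ) * (1 / 2) ≤ k.primeFactors.card * Real.log 2 :=
      mul_le_mul_of_nonneg_left (by linarith) (Nat.cast_nonneg _)
    linarith
  set X : ℝ := (r₀ : ℝ) * U ^ 2 with hXdef
  have hX0 : 0 < X := by positivity
  have hX1 : 1 ≤ X := by
    have h1 : (1 : ℝ) ≤ r₀ := by exact_mod_cast lt_of_lt_of_le hp.pos hr₀p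
    rw [hXdef]; exact one_le_mul_of_one_le_of_one_le h1 (one_le_pow₀ (by linarith))
  have hodd : ∀ d ∈ adm, d % 2 = 1 := by
    intro d hd
    rw [hadmdef, Finset.mem_filter, primesIoc, Finset.mem_filter, Finset.mem_Ioc] at hd
    exact Nat.odd_iff.mp (hd.1.2.odd_of_ne_two (by omega))
  have hmem : ∀ d ∈ adm, tf (αOf d) (k : ℤ) ∈ windowSet κ σ X := by
    intro d hd
    have hd2 := hodd d hd
    rw [hadmdef, Finset.mem_filter, primesIoc, Finset.mem_filter, Finset.mem_Ioc] at hd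
    obtain ⟨⟨⟨hAd, hdV⟩, hdp⟩, hdp', hdk⟩ := hd
    have hd0 : (0 : ℝ) < d := by exact_mod_cast hdp.pos
    set ℓd : ℝ := Real.log d with hℓddef
    have hdU : (d : ℝ) ≤ U := le_trans (by exact_mod_cast hdV) hVU
    have hℓdU : ℓd ≤ ℓU := by rw [← hlogU]; exact Real.log_le_log hd0 hdU
    have hℓLd : ℓL < ℓd := by
      have hLd : L < d := lt_of_le_of_lt (Nat.le_ceil L) (by exact_mod_cast lt_of_le_of_lt hAL hAd)
      have := Real.log_lt_log hL0 hLd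
      rwa [hLdef, Real.log_exp] at this
    have hlogN : Real.log ((d : ℝ) ^ 2 * (r₀ : ℝ)) = 2 * ℓd + ρ := by
      rw [Real.log_mul (by positivity) hr₀0.ne', Real.log_pow]; push_cast; ring
    have hlogM : Real.log ((d : ℝ) ^ 6 * ((mOf k : ℕ) : ℝ) ^ 3) = 6 * ℓd + 3 * Lm := by
      rw [Real.log_mul (by positivity) (by positivity), Real.log_pow, Real.log_pow]; push_cast; ring
    refine tf_mem_window hp hj0 hq hk hdp (by omega) hdp' hdk (αOf_spec hd2) ?_ ?_ ?_
    · rw [hXdef, mul_comm]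
      exact mul_le_mul_of_nonneg_left (pow_le_pow_left₀ hd0.le hdU 2) hr₀0.le
    · rw [hlogN, hlogM]
      have : (2 * κ - 6) * ℓd ≤ (2 * κ - 6) * ℓU := mul_le_mul_of_nonneg_left hℓdU h26.le
      linarith [hLm_lo, hℓU_mul, this]
    · rw [hlogN, hlogM]
      have : (2 * σ - 6) * ℓL ≤ (2 * σ - 6) * ℓd := mul_le_mul_of_nonneg_left hℓLd.le h2σ.le
      linarith [hℓL_mul, this]
  have hinj : Set.InjOn (fun d => tf (αOf d) (k : ℤ)) ↑adm := fun d hd d' hd' h =>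
    tf_αOf_injOn k (hodd d hd) (hodd d' hd') h
  have hcount : (adm.card : ℝ) ≤ (windowCount κ σ X : ℝ) := by
    exact_mod_cast card_le_windowCount_of_forall_mem adm _ hinj hmem
  ------------------------------------------------------------------
  -- the law at `X` and the contradiction
  ------------------------------------------------------------------
  have hlogX : Real.log X = ρ + 2 * ℓU := by
    rw [hXdef, Real.log_mul hr₀0.ne' (by positivity), Real.log_pow, hlogU]; push_cast; ring
  have hXδ : X ^ δ = Real.exp (δ * ρ + 2 * δ * ℓU) := by
    rw [Real.rpow_def_of_pos hX0, hlogX]; ring_nf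
  set R : ℝ := C * Real.exp (δ * ρ + 2 * δ * ℓU) with hRdef
  have hadmR : (adm.card : ℝ) ≤ R := by rw [hRdef, ← hXδ]; exact hcount.trans (hlaw X hX1)
  have hα' : (2 * j * P + 1) * ℓU ≤ U / 16 := by
    have h0 : (4 : ℝ) * 1 ≤ j * P := mul_le_mul hj4 hP1 (by norm_num) (by positivity)
    have h2 : (2 * j * P + 1) * ℓU ≤ 3 * j * P * (a' * P) :=
      mul_le_mul (by linarith) hℓU_hi hℓU0.le (by positivity)
    linarith [hU_E3]
  have hβ' : R * ℓU < U / 16 := by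
    have E1 : (2 * κ - 6) * ((1 - 2 * δ) * ℓU - δ * ρ) =
        (1 - 2 * δ) * (6 * j * P - Real.log 8) - (κ - 6 * δ) * ρ := by
      have : (2 * κ - 6) * ((1 - 2 * δ) * ℓU - δ * ρ) =
          (1 - 2 * δ) * ((2 * κ - 6) * ℓU) - (2 * κ - 6) * δ * ρ := by ring
      rw [this, hℓU_mul]; ring
    have E3 : (2 * κ - 6) * (γ * P - c₀) =
        ((6 * j - κ * (j + 1)) * (1 - 2 * δ) - (j + 1) * δ * (2 * κ - 6)) * P - Real.log 8 := by
      have : (2 * κ - 6) * (γ * P - c₀) = ((2 * κ - 6) * γ) * P - (2 * κ - 6) * c₀ := by ring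
      rw [this, hγ_mul, hc₀_mul]
    have E4 : (2 * κ - 6) * ((1 - 2 * δ) * ℓU - δ * ρ) - (2 * κ - 6) * (γ * P - c₀) =
        (κ - 6 * δ) * ((j + 1) * P - ρ) + 2 * δ * Real.log 8 := by rw [E1, E3]; ring
    have hpos : 0 ≤ (κ - 6 * δ) * ((j + 1) * P - ρ) + 2 * δ * Real.log 8 :=
      add_nonneg (mul_nonneg h6δ.le (by linarith)) (by positivity)
    have hexp1 : γ * P - c₀ ≤ (1 - 2 * δ) * ℓU - δ * ρ := by
      have : (2 * κ - 6) * (γ * P - c₀) ≤ (2 * κ - 6) * ((1 - 2 * δ) * ℓU - δ * ρ) := by linarith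
      exact le_of_mul_le_mul_left this h26
    have hpγ : Real.exp (γ * P) = (p : ℝ) ^ γ := by rw [Real.rpow_def_of_pos hp0, hPdef, mul_comm]
    have h1 : 32 * C * a' * P ≤ Real.exp (γ * P - c₀) := by
      rw [Real.exp_sub, hpγ, le_div_iff₀ hexpc₀]
      have e : 32 * C * a' * P * Real.exp c₀ = 32 * C * a' * Real.exp c₀ * P := by ring
      rw [e]; exact hE4
    have h2 : 16 * C * ℓU < Real.exp ((1 - 2 * δ) * ℓU - δ * ρ) := by
      have h3 : 16 * C * ℓU ≤ 16 * C * (a' * P) := mul_le_mul_of_nonneg_left hℓU_hi (by linarith)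
      have h4 : 0 < C * a' * P := mul_pos (mul_pos hC0 ha') (by linarith)
      have h5 := Real.exp_le_exp.mpr hexp1
      linarith
    have hUsplit : U = Real.exp ((1 - 2 * δ) * ℓU - δ * ρ) * Real.exp (δ * ρ + 2 * δ * ℓU) := by
      rw [hUdef, ← Real.exp_add]; ring_nf
    have hE0 : 0 < Real.exp (δ * ρ + 2 * δ * ℓU) := Real.exp_pos _
    rw [hRdef, hUsplit, lt_div_iff₀ (by norm_num)]
    have h6 := mul_lt_mul_of_pos_right h2 hE0
    linarith
  have hfin : N₁ * ℓU ≤ (R + (2 * j * P + 1)) * ℓU := by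
    apply mul_le_mul_of_nonneg_right _ hℓU0.le
    linarith [hcompl, hpf, hadmR]
  have hfin' : (R + (2 * j * P + 1)) * ℓU < U / 8 := by linarith
  linarith

/-! ### 4.5 `6 < σ` is sharp: the conclusion fails at `σ = 6`; corollaries -/

/-- The conclusion of `ModerateWindowCount` at the excluded endpoint `σ = 6`. -/
def ModerateWindowLawAtSix : Prop :=
  ∃ κ δ C : ℝ, 3 < κ ∧ κ < 6 ∧ δ < (6 - κ) / (2 * 6 - 6) ∧
    ∀ X : ℝ, 1 ≤ X → (windowCount κ 6 X : ℝ) ≤ C * X ^ δ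

/-- **No window law below the conjectural exponent inside `(3, 6]`.** For `3 < κ < σ ≤ 6`, every
`δ < (6−κ)/6 = 1 − κ/6` and every constant, `T_[κ,σ](X) ≤ C X^δ` fails for some `X ≥ 1` (twist
amplification on the quality-`≥ 1` triples `1 + (p^j − 1) = p^j`; see `sixSharp_core`). -/
theorem not_windowLaw_le_six {κ σ δ₀ C₀ : ℝ} (hκ3 : 3 < κ) (hκσ : κ < σ) (hσ6 : σ ≤ 6)
    (hδ₀ : δ₀ < (6 - κ) / 6) : ¬ ∀ X : ℝ, 1 ≤ X → (windowCount κ σ X : ℝ) ≤ C₀ * X ^ δ₀ := by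
  intro hlaw₀
  -- normalise: `0 ≤ δ < (6-κ)/6`, `1 ≤ C`
  set δ : ℝ := max δ₀ 0 with hδdef
  have hδ0 : 0 ≤ δ := le_max_right _ _
  have hδ : δ < (6 - κ) / 6 := max_lt hδ₀ (div_pos (by linarith) (by norm_num))
  set C : ℝ := max C₀ 1 with hCdef
  have hC1 : 1 ≤ C := le_max_right _ _
  have hC0 : 0 < C := by linarith
  have hlaw : ∀ X : ℝ, 1 ≤ X → (windowCount κ σ X : ℝ) ≤ C * X ^ δ := by
    intro X hX
    refine (hlaw₀ X hX).trans ?_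
    have hXδ : X ^ δ₀ ≤ X ^ δ := Real.rpow_le_rpow_of_exponent_le hX (le_max_left _ _)
    have h0 : 0 ≤ X ^ δ₀ := Real.rpow_nonneg (by linarith) _
    calc C₀ * X ^ δ₀ ≤ C * X ^ δ₀ := mul_le_mul_of_nonneg_right (le_max_left _ _) h0
      _ ≤ C * X ^ δ := mul_le_mul_of_nonneg_left hXδ (by linarith)
  have h26 : 0 < 2 * κ - 6 := by linarith
  have h2σ : 0 < 2 * σ - 6 := by linarith
  -- exponents
  obtain ⟨i, hi1, hnum, hγ⟩ := sixSharp_exponents hκ3 hδ0 hδ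
  set j : ℕ := 4 * i with hjdef
  have hj4 : (4 : ℝ) ≤ j := by
    rw [hjdef]; push_cast
    have : (1 : ℝ) ≤ i := by exact_mod_cast hi1
    linarith
  have hj0 : j ≠ 0 := by intro h; rw [h] at hj4; norm_num at hj4
  set a : ℝ := (6 * j - κ * ((j : ℝ) + 1)) / (2 * κ - 6) with hadef
  set a' : ℝ := 6 * (j : ℝ) / (2 * κ - 6) with ha'def
  set b : ℝ := 6 * (σ - κ) * ((j : ℝ) - 1) / ((2 * κ - 6) * (2 * σ - 6)) with hbdef
  set c₀ : ℝ := Real.log 8 / (2 * κ - 6) with hc₀def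
  set γ : ℝ := a * (1 - 2 * δ) - ((j : ℝ) + 1) * δ with hγdef
  have ha : 0 < a := by rw [hadef]; exact div_pos hnum h26
  have ha' : 0 < a' := by rw [ha'def]; exact div_pos (by positivity) h26
  have hb : 0 < b := by
    rw [hbdef]; exact div_pos (mul_pos (mul_pos (by norm_num) (by linarith)) (by linarith)) (mul_pos h26 h2σ)
  -- prime supply threshold and largeness conditions
  obtain ⟨T₀, hT₀⟩ := primesIoc_card_mul_log_ge
  set K₁ : ℝ := 2 * ((max T₀ 64 : ℕ) : ℝ) * Real.exp c₀ with hK₁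
  set K₂ : ℝ := 12 * Real.exp c₀ with hK₂
  set K₃ : ℝ := 48 * a' * j * Real.exp c₀ with hK₃
  set K₄ : ℝ := 32 * C * a' * Real.exp c₀ with hK₄
  have hK₃0 : 0 < K₃ := by rw [hK₃]; positivity
  have hK₄0 : 0 < K₄ := by
    rw [hK₄]; exact mul_pos (mul_pos (mul_pos (by norm_num) hC0) ha') (Real.exp_pos _)
  have hev : ∀ᶠ x : ℝ in Filter.atTop, 1 ≤ x ∧ K₁ ≤ x ^ a ∧ K₂ ≤ x ^ b ∧
      K₃ * (Real.log x) ^ 2 ≤ x ^ a ∧ K₄ * Real.log x ≤ x ^ γ := by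
    refine (Filter.eventually_ge_atTop 1).and ?_
    refine ((tendsto_rpow_atTop ha).eventually_ge_atTop K₁).and ?_
    refine ((tendsto_rpow_atTop hb).eventually_ge_atTop K₂).and ?_
    refine (((isLittleO_log_rpow_rpow_atTop 2 ha).bound (inv_pos.mpr hK₃0)).mp ?_).and ?_
    · filter_upwards [Filter.eventually_ge_atTop (1 : ℝ)] with x hx h
      have hlx : 0 ≤ Real.log x := Real.log_nonneg hx
      rw [Real.norm_eq_abs, Real.norm_eq_abs, Real.rpow_two, abs_of_nonneg (by positivity),
        abs_of_nonneg (Real.rpow_nonneg (by linarith) _)] at h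
      have := mul_le_mul_of_nonneg_left h hK₃0.le
      rwa [← mul_assoc, mul_inv_cancel₀ hK₃0.ne', one_mul] at this
    · refine ((isLittleO_log_rpow_atTop hγ).bound (inv_pos.mpr hK₄0)).mp ?_
      filter_upwards [Filter.eventually_ge_atTop (1 : ℝ)] with x hx h
      have hlx : 0 ≤ Real.log x := Real.log_nonneg hx
      rw [Real.norm_eq_abs, Real.norm_eq_abs, abs_of_nonneg hlx,
        abs_of_nonneg (Real.rpow_nonneg (by linarith) _)] at h
      have := mul_le_mul_of_nonneg_left h hK₄0.le
      rwa [← mul_assoc, mul_inv_cancel₀ hK₄0.ne', one_mul] at this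
  obtain ⟨x₀, hx₀⟩ := Filter.eventually_atTop.mp hev
  obtain ⟨p, hpx, hp⟩ := Nat.exists_infinite_primes (max ⌈x₀⌉₊ 3)
  have hp3 : 3 ≤ p := le_of_max_le_right hpx
  have hpR : x₀ ≤ (p : ℝ) := (Nat.le_ceil x₀).trans (by exact_mod_cast le_of_max_le_left hpx)
  obtain ⟨-, hE1, hE2, hE3, hE4⟩ := hx₀ p hpR
  have hp2 : p % 2 = 1 := Nat.odd_iff.mp (hp.odd_of_ne_two (by omega))
  have hq16 : p ^ j % 16 = 1 := by rw [hjdef]; exact pow_four_mul_mod_sixteen hp2 i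
  rw [hK₁] at hE1; rw [hK₂] at hE2; rw [hK₃] at hE3; rw [hK₄] at hE4
  exact sixSharp_core hκ3 hκσ hσ6 hδ0 hδ hC1 hlaw hj0 hj4 hnum hT₀ hp hp3 hq16 hE1 hE2 hE3 hE4


/-- **MAIN NEGATIVE THEOREM.** At `σ = 6` the window law fails for every `κ ∈ (3,6)`, every
`δ < (6−κ)/6` and every constant: the hypothesis `6 < σ` of `ModerateWindowCount` is sharp. -/
theorem not_moderateWindowLawAtSix : ¬ ModerateWindowLawAtSix := by
  rintro ⟨κ, δ, C, hκ3, hκ6, hδ, hlaw⟩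
  have e : (6 - κ) / (2 * 6 - 6) = (6 - κ) / 6 := by norm_num
  rw [e] at hδ
  exact not_windowLaw_le_six hκ3 hκ6 le_rfl hδ hlaw

/-- **No saving at all inside `(3, 6]`**: for `3 < κ < σ ≤ 6` the amplification threshold
`(σ−κ)/(2σ−6)` is `≤ (6−κ)/6` (`(6−κ)(2σ−6) − 6(σ−κ) = 2(6−σ)(κ−3) ≥ 0`), so NO `δ` below it works:
a witness of the sibling crux `SomeWindowSaving` must have `σ > 6` (`someWindowSaving_sigma_gt_six`). -/
theorem no_windowSaving_le_six {κ σ δ C : ℝ} (hκ3 : 3 < κ) (hκσ : κ < σ) (hσ6 : σ ≤ 6)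
    (hδ : δ < (σ - κ) / (2 * σ - 6)) : ¬ ∀ X : ℝ, 1 ≤ X → (windowCount κ σ X : ℝ) ≤ C * X ^ δ := by
  refine not_windowLaw_le_six hκ3 hκσ hσ6 (hδ.trans_le ?_)
  rw [div_le_div_iff₀ (by linarith) (by norm_num)]
  nlinarith

/-- The sibling crux `SomeWindowSaving` (stmt-ABC-1976) can only be witnessed with `σ > 6`. -/
theorem someWindowSaving_sigma_gt_six (h : SomeWindowSaving) :
    ∃ κ σ δ C : ℝ, 3 < κ ∧ κ < σ ∧ 6 < σ ∧ δ < (σ - κ) / (2 * σ - 6) ∧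
      ∀ X : ℝ, 1 ≤ X → (windowCount κ σ X : ℝ) ≤ C * X ^ δ := by
  obtain ⟨κ, σ, δ, C, hκ3, hκσ, hδ, hlaw⟩ := h
  refine ⟨κ, σ, δ, C, hκ3, hκσ, ?_, hδ, hlaw⟩
  by_contra hσ
  push Not at hσ
  exact no_windowSaving_le_six hκ3 hκσ hσ hδ hlaw

/-- **Exponent floor for the crux (tightness).** For every `κ ∈ (3,6)`, every `σ > κ` and every
`δ < (6−κ)/6 = 1 − κ/6`, NO constant makes `T_[κ,σ](X) ≤ C X^δ` hold for all `X ≥ 1` (for `σ ≤ 6` by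
`not_windowLaw_le_six`; for `σ ≥ 6` windows grow with `σ`). Hence in `ModerateWindowCount` a witness
`(κ, δ)` with `κ < 6` is confined to the strip `1 − κ/6 ≤ δ < (σ−κ)/(2σ−6)`, of width
`(κ−3)(σ−6)/(3(2σ−6))` (the route's margin identity): the conjectural law `X^{1−κ/6}` is an
unconditional FLOOR for the crux's saving. -/
theorem T_not_bigO_below_law {σ κ δ C : ℝ} (hκ3 : 3 < κ) (hκ6 : κ < 6) (hκσ : κ < σ)
    (hδ : δ < (6 - κ) / 6) : ¬ ∀ X : ℝ, 1 ≤ X → (windowCount κ σ X : ℝ) ≤ C * X ^ δ := by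
  intro h
  rcases le_or_gt σ 6 with hσ | hσ
  · exact not_windowLaw_le_six hκ3 hκσ hσ hδ h
  · refine not_windowLaw_le_six hκ3 hκ6 le_rfl hδ (fun X hX => le_trans ?_ (h X hX))
    exact_mod_cast windowCount_mono le_rfl hσ.le X

/-- `ModerateWindowCount` with `6 < σ` weakened to `6 ≤ σ`. -/
def ModerateWindowCountFromSix : Prop :=
  ∀ σ : ℝ, 6 ≤ σ → ∃ κ δ C : ℝ, 3 < κ ∧ κ < σ ∧ δ < (σ - κ) / (2 * σ - 6) ∧
    ∀ X : ℝ, 1 ≤ X → (windowCount κ σ X : ℝ) ≤ C * X ^ δ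

/-- `ModerateWindowCount` with `6 < σ` replaced by the bare `3 < σ` (the hypothesis dropped). -/
def ModerateWindowCountWithoutSixLtSigma : Prop :=
  ∀ σ : ℝ, 3 < σ → ∃ κ δ C : ℝ, 3 < κ ∧ κ < σ ∧ δ < (σ - κ) / (2 * σ - 6) ∧
    ∀ X : ℝ, 1 ≤ X → (windowCount κ σ X : ℝ) ≤ C * X ^ δ

/-- **`6 < σ` is sharp**: the `6 ≤ σ` version is FALSE (instance `σ = 6`). -/
theorem not_moderateWindowCountFromSix : ¬ ModerateWindowCountFromSix := fun h =>
  not_moderateWindowLawAtSix (by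
    obtain ⟨κ, δ, C, h1, h2, h3, h4⟩ := h 6 le_rfl
    exact ⟨κ, δ, C, h1, h2, h3, h4⟩)

/-- **`6 < σ` is load-bearing**: with the hypothesis dropped the statement is FALSE. -/
theorem moderateWindowCount_false_without_sixLtSigma : ¬ ModerateWindowCountWithoutSixLtSigma := fun h =>
  not_moderateWindowLawAtSix (by
    obtain ⟨κ, δ, C, h1, h2, h3, h4⟩ := h 6 (by norm_num)
    exact ⟨κ, δ, C, h1, h2, h3, h4⟩)

/-! ### 6.0 Finiteness engine for reduced models with capped `M⁺` (no minimality needed) -/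

/-- Reduced models in an `(a₄, a₆)`-box. -/
def box (K L : ℤ) : Set (WeierstrassCurve ℤ) :=
  {W | (W.a₁ = 0 ∨ W.a₁ = 1) ∧ (W.a₃ = 0 ∨ W.a₃ = 1) ∧ (W.a₂ = -1 ∨ W.a₂ = 0 ∨ W.a₂ = 1) ∧
    |W.a₄| ≤ K ∧ |W.a₆| ≤ L}

theorem box_finite (K L : ℤ) : (box K L).Finite := by
  have hinj : Set.InjOn (fun W : WeierstrassCurve ℤ => (W.a₁, W.a₂, W.a₃, W.a₄, W.a₆)) (box K L) := by
    intro W _ W' _ h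
    simp only [Prod.mk.injEq] at h
    obtain ⟨h1, h2, h3, h4, h6⟩ := h
    ext <;> assumption
  refine Set.Finite.of_finite_image ?_ hinj
  refine Set.Finite.subset (Finset.finite_toSet (Finset.Icc (-1 : ℤ) 1 ×ˢ Finset.Icc (-1 : ℤ) 1 ×ˢ
    Finset.Icc (-1 : ℤ) 1 ×ˢ Finset.Icc (-K) K ×ˢ Finset.Icc (-L) L)) ?_
  rintro _ ⟨W, hW, rfl⟩
  obtain ⟨h₁, h₃, h₂, h₄, h₆⟩ := hW
  simp only [Finset.coe_product, Finset.coe_Icc, Set.mem_prod, Set.mem_Icc]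
  refine ⟨⟨?_, ?_⟩, ⟨?_, ?_⟩, ⟨?_, ?_⟩, abs_le.mp h₄, abs_le.mp h₆⟩ <;> omega

/-- Coefficient bounds for a reduced model from bounds on `c₄` and `c₆`. -/
theorem abs_a₄_a₆_le (W : WeierstrassCurve ℤ) (h₁ : W.a₁ = 0 ∨ W.a₁ = 1) (h₃ : W.a₃ = 0 ∨ W.a₃ = 1)
    (h₂ : W.a₂ = -1 ∨ W.a₂ = 0 ∨ W.a₂ = 1) (B : ℤ) (hc₄ : |W.c₄| ≤ B) (hc₆ : |W.c₆| ≤ B) :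
    |W.a₄| ≤ B + 49 ∧ |W.a₆| ≤ 2 * B + 400 := by
  obtain ⟨a₁, a₂, a₃, a₄, a₆⟩ := W
  simp only at h₁ h₂ h₃ hc₄ hc₆ ⊢
  simp only [WeierstrassCurve.c₄, WeierstrassCurve.c₆, WeierstrassCurve.b₂, WeierstrassCurve.b₄,
    WeierstrassCurve.b₆] at hc₄ hc₆
  rw [abs_le] at hc₄ hc₆
  rcases h₁ with rfl | rfl <;> rcases h₃ with rfl | rfl <;> rcases h₂ with rfl | rfl | rfl <;>
    refine ⟨abs_le.mpr ⟨?_, ?_⟩, abs_le.mpr ⟨?_, ?_⟩⟩ <;> nlinarith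

/-- **Finiteness engine.** Reduced integral models with capped `M⁺ = max |Δ| |c₄|³ ≤ B` form a
finite set. -/
theorem reducedCap_finite (B : ℤ) :
    {W : WeierstrassCurve ℤ | (W.a₁ = 0 ∨ W.a₁ = 1) ∧ (W.a₃ = 0 ∨ W.a₃ = 1) ∧
      (W.a₂ = -1 ∨ W.a₂ = 0 ∨ W.a₂ = 1) ∧ max |W.Δ| (|W.c₄| ^ 3) ≤ B}.Finite := by
  rcases lt_or_ge B 0 with hB0 | hB0
  · convert Set.finite_empty
    ext W
    simp only [Set.mem_setOf_eq, Set.mem_empty_iff_false, iff_false, not_and]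
    intro _ _ _ h
    have : (0 : ℤ) ≤ max |W.Δ| (|W.c₄| ^ 3) := le_max_of_le_left (abs_nonneg _)
    omega
  refine (box_finite (B ^ 3 + 1728 * B + 49) (2 * (B ^ 3 + 1728 * B) + 400)).subset ?_
  intro W hW
  obtain ⟨h₁, h₃, h₂, hMB⟩ := hW
  have hΔ : |W.Δ| ≤ B := (le_max_left _ _).trans hMB
  have hc₄3 : |W.c₄| ^ 3 ≤ B := (le_max_right _ _).trans hMB
  have hc₄ : |W.c₄| ≤ B := by
    rcases le_or_gt |W.c₄| 1 with h | h
    · rcases (abs_nonneg W.c₄).eq_or_lt with h0 | h0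
      · rw [← h0]; exact hB0
      · calc |W.c₄| ≤ 1 := h
          _ ≤ |W.c₄| ^ 3 := one_le_pow₀ (by omega)
          _ ≤ B := hc₄3
    · calc |W.c₄| ≤ |W.c₄| ^ 3 := le_self_pow₀ h.le (by norm_num)
        _ ≤ B := hc₄3
  have hrel : W.c₆ ^ 2 = W.c₄ ^ 3 - 1728 * W.Δ := by
    have := W.c_relation; linarith
  have habs : |W.c₆| ≤ W.c₆ ^ 2 := by
    rcases le_or_gt 0 W.c₆ with h | h
    · rw [abs_of_nonneg h]; nlinarith
    · rw [abs_of_neg h]; nlinarith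
  have hc₆ : |W.c₆| ≤ B ^ 3 + 1728 * B := by
    calc |W.c₆| ≤ W.c₆ ^ 2 := habs
      _ = W.c₄ ^ 3 - 1728 * W.Δ := hrel
      _ ≤ |W.c₄| ^ 3 + 1728 * |W.Δ| := by
          have h1 : W.c₄ ^ 3 ≤ |W.c₄| ^ 3 := by
            calc W.c₄ ^ 3 ≤ |W.c₄ ^ 3| := le_abs_self _
              _ = |W.c₄| ^ 3 := abs_pow _ _
          have h2 : -(1728 * W.Δ) ≤ 1728 * |W.Δ| := by
            have := neg_abs_le W.Δ; linarith
          linarith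
      _ ≤ B ^ 3 + 1728 * B := by
          have : |W.c₄| ^ 3 ≤ B ^ 3 := pow_le_pow_left₀ (abs_nonneg _) hc₄ 3
          linarith
  have hc₄' : |W.c₄| ≤ B ^ 3 + 1728 * B := by
    have : (0 : ℤ) ≤ B ^ 3 := by positivity
    linarith
  obtain ⟨h4, h6⟩ := abs_a₄_a₆_le W h₁ h₃ h₂ _ hc₄' hc₆
  exact ⟨h₁, h₃, h₂, h4, h6⟩

/-! ## 6. Minimality IS load-bearing for the target as typed

Unlike the CM exclusions, dropping "minimal at every place" cannot be escaped by taking `κ > 6`: the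
integral rescalings `u ↦ 1/k` of ONE curve multiply `M⁺` by `k¹²` at fixed conductor, so every curve of
ratio `β` acquires members at every ratio `≥ β`. Certified below at `σ = 7` (any fixed `σ > 6` would do) for
EVERY `κ ∈ (3,7)`, `δ < (7−κ)/8`: the family `sc b k : y² = x³ − b²k⁴x + b³k⁶` (`b ≥ 29` prime, `k ≥ 1`; the
`k`-rescaling of the prime twist `tw b` of `y² = x³ − x + 1`, sibling file §§2.1, 7, whose lemmas are
re-certified here in this namespace) has conductor `N_b ∈ [b², 368 b²]` independent of `k` and
`M⁺ = 110592 b⁶ k¹²`; at `X = 368 B²` the pairs `b ∈ (B^{1−η}, B]`, `k ∈ (K₁, K₂]`,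
`η = (7−κ)/14`, give `≫ B^{1 + 2(1−η)/3}/log B ≥ X^{1/2 + …}` members, against `C X^δ`, `δ < 1/2`.

### 6.1 The family (re-certified from the sibling crux file) -/

/-- Quadratic twist by `d` of `y² = x³ − x + 1` (conductor `92 = 4·23`; `Δ₀ = −368`). -/
def tw (d : ℕ) : WeierstrassCurve ℤ := ⟨0, 0, 0, -((d : ℤ) ^ 2), (d : ℤ) ^ 3⟩

theorem tw_c₄ (d : ℕ) : (tw d).c₄ = 48 * (d : ℤ) ^ 2 := by
  simp only [tw, WeierstrassCurve.c₄, WeierstrassCurve.b₂, WeierstrassCurve.b₄]; ring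

theorem tw_Δ (d : ℕ) : (tw d).Δ = -368 * (d : ℤ) ^ 6 := by
  simp only [tw, WeierstrassCurve.Δ, WeierstrassCurve.b₂, WeierstrassCurve.b₄, WeierstrassCurve.b₆,
    WeierstrassCurve.b₈]; ring

theorem tw_isElliptic (d : ℕ) [NeZero d] : ((tw d).baseChange ℚ).IsElliptic := by
  refine ⟨?_⟩
  rw [baseChange_int_Δ, tw_Δ, isUnit_iff_ne_zero]
  have : (d : ℚ) ≠ 0 := by exact_mod_cast NeZero.ne d
  push_cast
  exact mul_ne_zero (by norm_num) (pow_ne_zero _ this)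

/-- Minimality of `tw d` at every place for prime `d ≥ 3`, `d ≠ 23` (`v_p(Δ) ≤ 6 < 12`). -/
theorem tw_isMinimalAt {d : ℕ} (hd : d.Prime) (h3 : 3 ≤ d) (h23 : d ≠ 23) (v : HeightOneSpectrum ℤ) :
    ((tw d).baseChange ℚ).IsMinimalAt v := by
  apply isMinimalAt_baseChange_int_of_not_pow_dvd_Δ
  rw [tw_Δ]
  set p := Rat.HeightOneSpectrum.natGenerator v with hp
  have hpp : p.Prime := Rat.HeightOneSpectrum.prime_natGenerator v
  intro hdvd
  have hdvd' : p ^ 12 ∣ 368 * d ^ 6 := by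
    have e : -(-368 * (d : ℤ) ^ 6) = ((368 * d ^ 6 : ℕ) : ℤ) := by push_cast; ring
    have : ((p : ℤ) ^ 12) ∣ ((368 * d ^ 6 : ℕ) : ℤ) := by rw [← dvd_neg, e] at hdvd; exact hdvd
    exact_mod_cast this
  by_cases hpd : p = d
  · subst hpd
    have h6 : p ^ 6 ∣ 368 := by
      have : p ^ 12 = p ^ 6 * p ^ 6 := by ring
      rw [this, mul_comm 368] at hdvd'
      exact (Nat.mul_dvd_mul_iff_left (by positivity)).mp hdvd'
    have : p ^ 6 ≤ 368 := Nat.le_of_dvd (by norm_num) h6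
    have h36 : 3 ^ 6 ≤ p ^ 6 := Nat.pow_le_pow_left h3 6
    norm_num at h36
    omega
  · have hcop : Nat.Coprime (p ^ 12) (d ^ 6) :=
      Nat.Coprime.pow _ _ ((Nat.coprime_primes hpp hd).mpr hpd)
    have h368 : p ^ 12 ∣ 368 := hcop.dvd_of_dvd_mul_right hdvd'
    have hle : p ^ 12 ≤ 368 := Nat.le_of_dvd (by norm_num) h368
    have h2 : 2 ^ 12 ≤ p ^ 12 := Nat.pow_le_pow_left hpp.two_le 12
    norm_num at h2
    omega

/-- Rescaled (non-minimal for `k ≥ 2`) models of `tw b`: `sc b k : y² = x³ − b²k⁴ x + b³k⁶`. -/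
def sc (b k : ℕ) : WeierstrassCurve ℤ := ⟨0, 0, 0, -((b : ℤ) ^ 2 * (k : ℤ) ^ 4), (b : ℤ) ^ 3 * (k : ℤ) ^ 6⟩

theorem sc_c₄ (b k : ℕ) : (sc b k).c₄ = 48 * (b : ℤ) ^ 2 * (k : ℤ) ^ 4 := by
  simp only [sc, WeierstrassCurve.c₄, WeierstrassCurve.b₂, WeierstrassCurve.b₄]; ring

theorem sc_c₆ (b k : ℕ) : (sc b k).c₆ = -864 * (b : ℤ) ^ 3 * (k : ℤ) ^ 6 := by
  simp only [sc, WeierstrassCurve.c₆, WeierstrassCurve.b₂, WeierstrassCurve.b₄, WeierstrassCurve.b₆]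
  ring

theorem sc_Δ (b k : ℕ) : (sc b k).Δ = -368 * (b : ℤ) ^ 6 * (k : ℤ) ^ 12 := by
  simp only [sc, WeierstrassCurve.Δ, WeierstrassCurve.b₂, WeierstrassCurve.b₄, WeierstrassCurve.b₆,
    WeierstrassCurve.b₈]
  ring

theorem sc_maxInv (b k : ℕ) :
    max |(sc b k).Δ| (|(sc b k).c₄| ^ 3) = 110592 * (b : ℤ) ^ 6 * (k : ℤ) ^ 12 := by
  rw [sc_Δ, sc_c₄, abs_mul, abs_mul, abs_mul, abs_mul, abs_of_nonpos (by norm_num : (-368 : ℤ) ≤ 0),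
    abs_of_nonneg (by norm_num : (0 : ℤ) ≤ 48), abs_pow, abs_pow, abs_pow, abs_pow, Nat.abs_cast,
    Nat.abs_cast]
  rw [max_eq_right]
  · ring
  · have : (0 : ℤ) ≤ (b : ℤ) ^ 6 * (k : ℤ) ^ 12 := by positivity
    nlinarith

theorem sc_isElliptic (b k : ℕ) [NeZero b] [NeZero k] : ((sc b k).baseChange ℚ).IsElliptic := by
  refine ⟨?_⟩
  rw [baseChange_int_Δ, sc_Δ, isUnit_iff_ne_zero]
  have hb : (b : ℚ) ≠ 0 := by exact_mod_cast NeZero.ne b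
  have hk : (k : ℚ) ≠ 0 := by exact_mod_cast NeZero.ne k
  push_cast
  exact mul_ne_zero (mul_ne_zero (by norm_num) (pow_ne_zero _ hb)) (pow_ne_zero _ hk)

/-- `sc b k ⊗ ℚ` is the variable change `u = 1/k` of `tw b ⊗ ℚ`. -/
theorem sc_baseChange_eq_smul (b k : ℕ) (hk : (k : ℚ) ≠ 0) :
    (sc b k).baseChange ℚ = (⟨(Units.mk0 (k : ℚ) hk)⁻¹, 0, 0, 0⟩ : VariableChange ℚ) • (tw b).baseChange ℚ := by
  ext
  · simp [sc, tw, baseChange, variableChange_a₁]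
  · simp [sc, tw, baseChange, variableChange_a₂]
  · simp [sc, tw, baseChange, variableChange_a₃]
  · simp [sc, tw, baseChange, variableChange_a₄]; ring
  · simp [sc, tw, baseChange, variableChange_a₆]; ring

/-- Same conductor as `tw b` (the conductor is a `ℚ`-isomorphism invariant). -/
theorem sc_conductorNorm (b k : ℕ) [NeZero b] (hk : (k : ℚ) ≠ 0) :
    ((sc b k).baseChange ℚ).conductorNorm ℤ = ((tw b).baseChange ℚ).conductorNorm ℤ := by
  haveI := tw_isElliptic b
  rw [sc_baseChange_eq_smul b k hk]
  exact conductorNorm_smul_rat _ _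

/-- Conductor bounds for the (minimal) base curve `tw b`, `b ≥ 29` prime: `b² ∣ N ∣ 368 b²`
(`f_b = 2`; `f₂ ≤ 4`, `f₂₃ ≤ 1`). -/
theorem tw_conductor_bounds {b : ℕ} (hb : b.Prime) (h29 : 29 ≤ b) :
    b ^ 2 ∣ ((tw b).baseChange ℚ).conductorNorm ℤ ∧ ((tw b).baseChange ℚ).conductorNorm ℤ ∣ 368 * b ^ 2 := by
  haveI : NeZero b := ⟨hb.ne_zero⟩
  haveI := tw_isElliptic b
  have hmin := tw_isMinimalAt hb (by omega) (by omega)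
  have hgen : ∀ p : Nat.Primes,
      Rat.HeightOneSpectrum.natGenerator ((Rat.HeightOneSpectrum.primesEquiv (R := ℤ)).symm p) = p :=
    Literature.NumberTheory.EllipticCurves.Rat.natGenerator_primesEquiv_symm
  have hfb : 2 ≤ ((tw b).baseChange ℚ).conductorExponent
      ((Rat.HeightOneSpectrum.primesEquiv (R := ℤ)).symm ⟨b, hb⟩) := by
    apply two_le_conductorExponent_of_dvd_Δ_of_dvd_c₄ (hmin _)
    · rw [hgen ⟨b, hb⟩, tw_Δ]; exact Dvd.intro (-368 * (b : ℤ) ^ 5) (by push_cast; ring)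
    · rw [hgen ⟨b, hb⟩, tw_c₄]; exact Dvd.intro (48 * (b : ℤ)) (by push_cast; ring)
  constructor
  · apply (Nat.Prime.pow_dvd_iff_le_factorization hb (conductorNorm_pos_holds _).ne').mpr
    rw [factorization_conductorNorm_primesEquiv_symm _ ⟨b, hb⟩]
    exact hfb
  · apply conductorNorm_dvd_of_forall_conductorExponent_le _ (by positivity)
    intro p
    set v := (Rat.HeightOneSpectrum.primesEquiv (R := ℤ)).symm p with hv
    have hp : (p : ℕ).Prime := p.2
    have h0 : (368 * b ^ 2) ≠ 0 := by positivity
    by_cases hpb : (p : ℕ) = b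
    · have h5' : 5 ≤ Rat.HeightOneSpectrum.natGenerator v := by rw [hgen p, hpb]; omega
      have hle := (conductorExponent_le_two_of_five_le_natGenerator_holds ((tw b).baseChange ℚ) v) h5'
      refine hle.trans ?_
      apply (Nat.Prime.pow_dvd_iff_le_factorization hp h0).mp
      rw [hpb]; exact Dvd.intro_left 368 rfl
    · by_cases hpΔ : ((Rat.HeightOneSpectrum.natGenerator v : ℕ) : ℤ) ∣ (tw b).Δ
      · have e : -(-368 * (b : ℤ) ^ 6) = ((368 * b ^ 6 : ℕ) : ℤ) := by push_cast; ring
        rw [hgen p, tw_Δ] at hpΔ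
        have hp368 : (p : ℕ) ∣ 368 := by
          have h1 : (p : ℕ) ∣ 368 * b ^ 6 := by
            have : ((p : ℕ) : ℤ) ∣ ((368 * b ^ 6 : ℕ) : ℤ) := by
              rw [← dvd_neg, e] at hpΔ; exact hpΔ
            exact_mod_cast this
          rcases (Nat.Prime.dvd_mul hp).mp h1 with h | h
          · exact h
          · exact absurd ((Nat.prime_dvd_prime_iff_eq hp hb).mp (hp.dvd_of_dvd_pow h)) hpb
        have hp2or23 : (p : ℕ) = 2 ∨ (p : ℕ) = 23 := by
          have : (p : ℕ) ∣ 2 ^ 4 * 23 := by norm_num; exact hp368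
          rcases (Nat.Prime.dvd_mul hp).mp this with h | h
          · exact Or.inl ((Nat.prime_dvd_prime_iff_eq hp Nat.prime_two).mp (hp.dvd_of_dvd_pow h))
          · exact Or.inr ((Nat.prime_dvd_prime_iff_eq hp (by norm_num)).mp h)
        have hbodd2 : ¬ (2 : ℕ) ∣ b := fun h => by
          have := (Nat.prime_dvd_prime_iff_eq Nat.prime_two hb).mp h; omega
        have hb23 : ¬ (23 : ℕ) ∣ b := fun h => by
          have := (Nat.prime_dvd_prime_iff_eq (by norm_num) hb).mp h; omega
        rcases hp2or23 with h2 | h23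
        · have hlt : ((tw b).baseChange ℚ).conductorExponent v < 5 := by
            apply conductorExponent_lt_of_not_pow_dvd (hmin v)
            rw [hgen p, h2, tw_Δ]
            intro hd
            have hd' : 2 ^ 5 ∣ 368 * b ^ 6 := by
              rw [← dvd_neg, e] at hd
              exact_mod_cast hd
            have hcop : Nat.Coprime (2 ^ 5) (b ^ 6) :=
              Nat.Coprime.pow _ _ ((Nat.Prime.coprime_iff_not_dvd Nat.prime_two).mpr hbodd2)
            have := hcop.dvd_of_dvd_mul_right hd'
            norm_num at this
          have : 4 ≤ (368 * b ^ 2).factorization (p : ℕ) := by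
            apply (Nat.Prime.pow_dvd_iff_le_factorization hp h0).mp
            rw [h2]; exact Dvd.intro (23 * b ^ 2) (by ring)
          omega
        · have hlt : ((tw b).baseChange ℚ).conductorExponent v < 2 := by
            apply conductorExponent_lt_of_not_pow_dvd (hmin v)
            rw [hgen p, h23, tw_Δ]
            intro hd
            have hd' : 23 ^ 2 ∣ 368 * b ^ 6 := by
              rw [← dvd_neg, e] at hd
              exact_mod_cast hd
            have hcop : Nat.Coprime (23 ^ 2) (b ^ 6) :=
              Nat.Coprime.pow _ _ ((Nat.Prime.coprime_iff_not_dvd (by norm_num)).mpr hb23)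
            have := hcop.dvd_of_dvd_mul_right hd'
            norm_num at this
          have : 1 ≤ (368 * b ^ 2).factorization (p : ℕ) := by
            apply (Nat.Prime.pow_dvd_iff_le_factorization hp h0).mp
            rw [h23]; exact Dvd.intro (16 * b ^ 2) (by ring)
          omega
      · rw [conductorExponent_eq_zero_of_not_dvd_Δ (hmin v) hpΔ]
        exact Nat.zero_le _

/-- Conductor bounds for `sc b k` (`b ≥ 29` prime, `k ≥ 1`): `b² ≤ N ≤ 368 b²`, as reals. -/
theorem sc_conductor_bounds {b k : ℕ} (hb : b.Prime) (h29 : 29 ≤ b) (hk : k ≠ 0) :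
    haveI : NeZero b := ⟨hb.ne_zero⟩; haveI : NeZero k := ⟨hk⟩
    (b : ℝ) ^ 2 ≤ ((((sc b k).baseChange ℚ).conductorNorm ℤ : ℕ) : ℝ) ∧
      ((((sc b k).baseChange ℚ).conductorNorm ℤ : ℕ) : ℝ) ≤ 368 * (b : ℝ) ^ 2 := by
  haveI : NeZero b := ⟨hb.ne_zero⟩
  haveI : NeZero k := ⟨hk⟩
  haveI := tw_isElliptic b
  have hkQ : (k : ℚ) ≠ 0 := by exact_mod_cast hk
  rw [sc_conductorNorm b k hkQ]
  obtain ⟨hlo, hhi⟩ := tw_conductor_bounds hb h29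
  have hN : 0 < ((tw b).baseChange ℚ).conductorNorm ℤ := conductorNorm_pos_holds _
  constructor
  · exact_mod_cast Nat.le_of_dvd hN hlo
  · exact_mod_cast Nat.le_of_dvd (by positivity) hhi

/-- `(b, k) ↦ sc b k` is injective on `{b prime} × ℕ` (read `b k²` off `a₄ = −b²k⁴`, `a₆ = b³k⁶`, then use
that `v_b (b k²)` is odd while `v_b (b' k'²)` is even for a prime `b' ≠ b`). -/
theorem sc_injective {b b' k k' : ℕ} (hb : b.Prime) (hb' : b'.Prime) (hk : k ≠ 0) (hk' : k' ≠ 0)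
    (h : sc b k = sc b' k') : b = b' ∧ k = k' := by
  have h4 : (sc b k).a₄ = (sc b' k').a₄ := by rw [h]
  have h6 : (sc b k).a₆ = (sc b' k').a₆ := by rw [h]
  simp only [sc] at h4 h6
  have h4' : b ^ 2 * k ^ 4 = b' ^ 2 * k' ^ 4 := by
    have : (b : ℤ) ^ 2 * (k : ℤ) ^ 4 = (b' : ℤ) ^ 2 * (k' : ℤ) ^ 4 := by linarith
    exact_mod_cast this
  have h6' : b ^ 3 * k ^ 6 = b' ^ 3 * k' ^ 6 := by exact_mod_cast h6
  -- `u = b k²` is determined: `u² = b²k⁴`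
  have hu : b * k ^ 2 = b' * k' ^ 2 := by
    have e1 : (b * k ^ 2) ^ 2 = (b' * k' ^ 2) ^ 2 := by
      calc (b * k ^ 2) ^ 2 = b ^ 2 * k ^ 4 := by ring
        _ = b' ^ 2 * k' ^ 4 := h4'
        _ = (b' * k' ^ 2) ^ 2 := by ring
    exact Nat.pow_left_injective (by norm_num) e1
  -- valuation parity at `b`
  have hbb' : b = b' := by
    by_contra hne
    have hv : (b * k ^ 2).factorization b = (b' * k' ^ 2).factorization b := by rw [hu]
    rw [Nat.factorization_mul hb.ne_zero (pow_ne_zero _ hk), Nat.factorization_mul hb'.ne_zero (pow_ne_zero _ hk'),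
      Nat.factorization_pow, Nat.factorization_pow, hb.factorization, hb'.factorization] at hv
    simp only [Finsupp.coe_add, Pi.add_apply, Finsupp.smul_apply, smul_eq_mul, Finsupp.single_eq_same,
      Finsupp.single_apply] at hv
    split_ifs at hv <;> omega
  subst hbb'
  refine ⟨rfl, ?_⟩
  have : k ^ 2 = k' ^ 2 := Nat.eq_of_mul_eq_mul_left hb.pos hu
  exact Nat.pow_left_injective (by norm_num) this

/-! ### 6.2 The window without minimality, membership of `sc b k`, and the count at `σ = 7` -/

/-- The crux window with the clause "minimal at every place" removed. -/
def windowNoMin (κ σ X : ℝ) : Set (WeierstrassCurve ℤ) :=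
  {W₀ : WeierstrassCurve ℤ | (W₀.baseChange ℚ).IsElliptic ∧
    (W₀.a₁ = 0 ∨ W₀.a₁ = 1) ∧ (W₀.a₃ = 0 ∨ W₀.a₃ = 1) ∧ (W₀.a₂ = -1 ∨ W₀.a₂ = 0 ∨ W₀.a₂ = 1) ∧
    W₀.c₄ ≠ 0 ∧ W₀.c₆ ≠ 0 ∧
    (((W₀.baseChange ℚ).conductorNorm ℤ : ℕ) : ℝ) ≤ X ∧
    (((W₀.baseChange ℚ).conductorNorm ℤ : ℕ) : ℝ) ^ κ ≤ ((max |W₀.Δ| (|W₀.c₄| ^ 3) : ℤ) : ℝ) ∧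
    ((max |W₀.Δ| (|W₀.c₄| ^ 3) : ℤ) : ℝ) ≤ (((W₀.baseChange ℚ).conductorNorm ℤ : ℕ) : ℝ) ^ σ}

/-- `ModerateWindowCount` with minimality dropped. -/
def ModerateWindowCountWithoutMinimality : Prop :=
  ∀ σ : ℝ, 6 < σ → ∃ κ δ C : ℝ, 3 < κ ∧ κ < σ ∧ δ < (σ - κ) / (2 * σ - 6) ∧
    ∀ X : ℝ, 1 ≤ X → (Set.ncard (windowNoMin κ σ X) : ℝ) ≤ C * X ^ δ

/-- The window without minimality is still finite (same engine: reducedness and `M⁺ ≤ max 1 X^σ`). -/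
theorem windowNoMin_finite (κ σ X : ℝ) : (windowNoMin κ σ X).Finite := by
  refine (reducedCap_finite (⌈max (1 : ℝ) (X ^ σ)⌉₊ : ℕ)).subset ?_
  intro W hW
  obtain ⟨hE, h₁, h₃, h₂, -, -, hNX, -, hM⟩ := hW
  refine ⟨h₁, h₃, h₂, ?_⟩
  haveI := hE
  have hN1 : (1 : ℝ) ≤ (((W.baseChange ℚ).conductorNorm ℤ : ℕ) : ℝ) := by
    exact_mod_cast conductorNorm_pos_holds (W.baseChange ℚ)
  have hM' : ((max |W.Δ| (|W.c₄| ^ 3) : ℤ) : ℝ) ≤ max 1 (X ^ σ) := by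
    refine hM.trans ?_
    rcases le_or_gt 0 σ with hσ | hσ
    · exact le_max_of_le_right (Real.rpow_le_rpow (by linarith) hNX hσ)
    · exact le_max_of_le_left (Real.rpow_le_one_of_one_le_of_nonpos hN1 hσ.le)
  have : ((max |W.Δ| (|W.c₄| ^ 3) : ℤ) : ℝ) ≤ ((⌈max (1 : ℝ) (X ^ σ)⌉₊ : ℕ) : ℝ) :=
    hM'.trans (Nat.le_ceil _)
  exact_mod_cast this

/-- **Membership of `sc b k` in `windowNoMin κ 7 X`** from the two ratio conditions in logarithmic
form (`b² ≤ N ≤ 368 b²`, `M⁺ = 110592 b⁶ k¹²`). -/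
theorem sc_mem_windowNoMin {κ : ℝ} (hκ : 0 ≤ κ) {b k : ℕ} (hb : b.Prime) (h29 : 29 ≤ b) (hk : k ≠ 0)
    {X : ℝ} (hX : 368 * (b : ℝ) ^ 2 ≤ X)
    (hlo : κ * Real.log (368 * (b : ℝ) ^ 2) ≤ Real.log (110592 * (b : ℝ) ^ 6 * (k : ℝ) ^ 12))
    (hhi : Real.log (110592 * (b : ℝ) ^ 6 * (k : ℝ) ^ 12) ≤ 7 * Real.log ((b : ℝ) ^ 2)) :
    sc b k ∈ windowNoMin κ 7 X := by
  haveI : NeZero b := ⟨hb.ne_zero⟩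
  haveI : NeZero k := ⟨hk⟩
  obtain ⟨hNlo, hNhi⟩ := sc_conductor_bounds hb h29 hk
  set N : ℝ := ((((sc b k).baseChange ℚ).conductorNorm ℤ : ℕ) : ℝ) with hNdef
  have hb0 : (0 : ℝ) < b := by exact_mod_cast hb.pos
  have hk0 : (0 : ℝ) < k := by exact_mod_cast Nat.pos_of_ne_zero hk
  have hb2 : (0 : ℝ) < (b : ℝ) ^ 2 := by positivity
  have hN0 : 0 < N := lt_of_lt_of_le hb2 hNlo
  have hM : (((max |(sc b k).Δ| (|(sc b k).c₄| ^ 3) : ℤ) : ℝ)) = 110592 * (b : ℝ) ^ 6 * (k : ℝ) ^ 12 := by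
    rw [sc_maxInv]; push_cast; ring
  have hM0 : (0 : ℝ) < 110592 * (b : ℝ) ^ 6 * (k : ℝ) ^ 12 := by positivity
  refine ⟨sc_isElliptic b k, Or.inl rfl, Or.inl rfl, Or.inr (Or.inl rfl), ?_, ?_, hNhi.trans hX, ?_, ?_⟩
  · rw [sc_c₄]; positivity
  · rw [sc_c₆]
    have : (0 : ℤ) < 864 * (b : ℤ) ^ 3 * (k : ℤ) ^ 6 := by
      have : (0 : ℤ) < b := by exact_mod_cast hb.pos
      have : (0 : ℤ) < k := by exact_mod_cast Nat.pos_of_ne_zero hk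
      positivity
    linarith
  · rw [hM, Real.rpow_def_of_pos hN0, ← Real.exp_log hM0]
    apply Real.exp_le_exp.mpr
    have h1 : Real.log N ≤ Real.log (368 * (b : ℝ) ^ 2) := Real.log_le_log hN0 hNhi
    nlinarith [mul_le_mul_of_nonneg_left h1 hκ]
  · rw [hM, Real.rpow_def_of_pos hN0, ← Real.exp_log hM0]
    apply Real.exp_le_exp.mpr
    have h1 : Real.log ((b : ℝ) ^ 2) ≤ Real.log N := Real.log_le_log hb2 hNlo
    linarith

set_option maxHeartbeats 800000 in
/-- **Core of the no-minimality count** at `σ = 7`: given the law with `δ < (7−κ)/8`, `1 ≤ C`, the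
Chebyshev threshold and a large integer `B` (`x = B`, `η = (7−κ)/14`, `L = log x`), contradiction. -/
theorem noMin_core {κ δ C : ℝ} (hκ3 : 3 < κ) (hκ7 : κ < 7) (hδ : δ < (7 - κ) / 8)
    (hC1 : 1 ≤ C) (hlaw : ∀ X : ℝ, 1 ≤ X → (Set.ncard (windowNoMin κ 7 X) : ℝ) ≤ C * X ^ δ)
    {T₀ : ℕ} (hT₀ : ∀ A T : ℕ, T₀ ≤ T → 6 * A + 1 ≤ T →
      (T : ℝ) / 4 ≤ (primesIoc A T).card * Real.log T)
    {B : ℕ} (hBT : T₀ ≤ B)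
    (h29 : (29 : ℝ) ≤ (B : ℝ) ^ (1 - (7 - κ) / 14))
    (hA : 6 * (B : ℝ) ^ (1 - (7 - κ) / 14) + 7 ≤ B)
    (hℓ : κ * Real.log 368 + 12 * Real.log 4 ≤ (7 - κ) * Real.log B)
    (hℓ₁ : Real.log 110592 ≤ (2 * κ - 6 + 6 * ((7 - κ) / 14)) * Real.log B)
    (hmain : 500 * C * Real.log B ≤ (B : ℝ) ^ (2 * (1 - (7 - κ) / 14) / 3 + 1 - 2 * δ)) : False := by
  set η : ℝ := (7 - κ) / 14 with hηdef
  have hη0 : 0 < η := by rw [hηdef]; linarith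
  have hη1 : η < 1 := by rw [hηdef]; linarith
  have hδ2 : δ < 1 / 2 := by have : (7 - κ) / 8 < 1 / 2 := by rw [div_lt_iff₀ (by norm_num)]; linarith
                             linarith
  have hC0 : 0 < C := by linarith
  set x : ℝ := (B : ℝ) with hxdef
  have hx29 : (29 : ℝ) ≤ x := by
    have h1 : (1 : ℝ) ≤ x := by
      by_contra h
      push Not at h
      have : x ^ (1 - η) ≤ 1 := Real.rpow_le_one (Nat.cast_nonneg _) h.le (by linarith)
      linarith
    calc (29 : ℝ) ≤ x ^ (1 - η) := h29
      _ ≤ x ^ (1 : ℝ) := Real.rpow_le_rpow_of_exponent_le h1 (by linarith)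
      _ = x := Real.rpow_one x
  have hx0 : 0 < x := by linarith
  set Lb : ℝ := Real.log x with hLbdef
  have hLb0 : 0 < Lb := Real.log_pos (by linarith)
  have hxη : x ^ (1 - η) = Real.exp ((1 - η) * Lb) := by
    rw [Real.rpow_def_of_pos hx0, hLbdef, mul_comm]
  -- `A` and the prime supply
  set A : ℕ := ⌈x ^ (1 - η)⌉₊ with hAdef
  have hAlo : x ^ (1 - η) ≤ A := Nat.le_ceil _
  have hAhi : (A : ℝ) < x ^ (1 - η) + 1 := Nat.ceil_lt_add_one (Real.rpow_nonneg hx0.le _)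
  have hA29 : 29 ≤ A := by
    have : (29 : ℝ) ≤ A := h29.trans hAlo
    exact_mod_cast this
  have hAB : 6 * A + 1 ≤ B := by
    have : (6 * A + 1 : ℝ) ≤ x := by linarith
    rw [hxdef] at this
    exact_mod_cast this
  have hsup := hT₀ A B hBT hAB
  -- the `k`-range
  set ℓ₁ : ℝ := (κ * Real.log 368 + (2 * κ - 6 + 6 * η) * Lb - Real.log 110592) / 12 with hℓ₁def
  set ℓ₂ : ℝ := (8 * (1 - η) * Lb - Real.log 110592) / 12 with hℓ₂def
  have hℓ₁0 : 0 ≤ ℓ₁ := by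
    have h1 : 0 ≤ κ * Real.log 368 := mul_nonneg (by linarith) (Real.log_nonneg (by norm_num))
    rw [hℓ₁def]
    apply div_nonneg _ (by norm_num)
    linarith
  have hℓ21 : ℓ₁ + Real.log 4 ≤ ℓ₂ := by
    rw [hℓ₁def, hℓ₂def]
    have e : 8 * (1 - η) - (2 * κ - 6 + 6 * η) = 7 - κ := by rw [hηdef]; ring
    have : (8 * (1 - η) * Lb - Real.log 110592) - (κ * Real.log 368 + (2 * κ - 6 + 6 * η) * Lb -
        Real.log 110592) = (7 - κ) * Lb - κ * Real.log 368 := by rw [← e]; ring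
    linarith
  set klo : ℕ := ⌈Real.exp ℓ₁⌉₊ with hklodef
  set khi : ℕ := ⌊Real.exp ℓ₂⌋₊ with hkhidef
  have hklo1 : 1 ≤ klo := by
    have : (1 : ℝ) ≤ klo := le_trans (by have := Real.one_le_exp hℓ₁0; linarith) (Nat.le_ceil _)
    exact_mod_cast this
  have hklo_hi : (klo : ℝ) < Real.exp ℓ₁ + 1 := Nat.ceil_lt_add_one (Real.exp_pos _).le
  have hkhi_lo : Real.exp ℓ₂ - 1 < khi := by
    have := Nat.lt_floor_add_one (Real.exp ℓ₂); linarith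
  have hkhi_hi : (khi : ℝ) ≤ Real.exp ℓ₂ := Nat.floor_le (Real.exp_pos _).le
  have hexp4 : Real.exp ℓ₂ ≥ 4 * Real.exp ℓ₁ := by
    have := Real.exp_le_exp.mpr hℓ21
    rwa [Real.exp_add, Real.exp_log (by norm_num), mul_comm] at this
  have he1 : 1 ≤ Real.exp ℓ₁ := Real.one_le_exp hℓ₁0
  set Ks : Finset ℕ := Finset.Icc klo khi with hKsdef
  have hKs_card : Real.exp ℓ₂ / 2 ≤ (Ks.card : ℝ) := by
    have h1 : (Ks.card : ℝ) = (khi : ℝ) + 1 - klo := by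
      rw [hKsdef, Nat.card_Icc]
      have : klo ≤ khi + 1 := by
        have : (klo : ℝ) ≤ khi + 1 := by linarith
        exact_mod_cast this
      push_cast [Nat.cast_sub this]; ring
    rw [h1]; linarith
  -- the pairs and their images
  classical
  set S : Finset (ℕ × ℕ) := (primesIoc A B) ×ˢ Ks with hSdef
  set X : ℝ := 368 * x ^ 2 with hXdef
  have hX1 : 1 ≤ X := by rw [hXdef]; nlinarith
  have hmemS : ∀ q ∈ S, q.1.Prime ∧ 29 ≤ q.1 ∧ (A : ℝ) < q.1 ∧ (q.1 : ℝ) ≤ x ∧ q.2 ≠ 0 ∧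
      ℓ₁ ≤ Real.log q.2 ∧ Real.log q.2 ≤ ℓ₂ := by
    intro q hq
    rw [hSdef, Finset.mem_product, primesIoc, Finset.mem_filter, Finset.mem_Ioc, hKsdef,
      Finset.mem_Icc] at hq
    obtain ⟨⟨⟨hAq, hqB⟩, hqp⟩, hk1, hk2⟩ := hq
    have hq0 : q.2 ≠ 0 := by omega
    have hq0R : (0 : ℝ) < q.2 := by exact_mod_cast Nat.pos_of_ne_zero hq0
    refine ⟨hqp, by omega, by exact_mod_cast hAq, by rw [hxdef]; exact_mod_cast hqB, hq0, ?_, ?_⟩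
    · have h1 : Real.exp ℓ₁ ≤ q.2 := le_trans (Nat.le_ceil _) (by exact_mod_cast hk1)
      have := Real.log_le_log (Real.exp_pos _) h1
      rwa [Real.log_exp] at this
    · have h1 : (q.2 : ℝ) ≤ Real.exp ℓ₂ := le_trans (by exact_mod_cast hk2) hkhi_hi
      have := Real.log_le_log hq0R h1
      rwa [Real.log_exp] at this
  have hmem : ∀ q ∈ S, sc q.1 q.2 ∈ windowNoMin κ 7 X := by
    intro q hq
    obtain ⟨hqp, hq29, hAq, hqx, hq0, hk1, hk2⟩ := hmemS q hq
    have hb0 : (0 : ℝ) < q.1 := by exact_mod_cast hqp.pos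
    have hk0 : (0 : ℝ) < q.2 := by exact_mod_cast Nat.pos_of_ne_zero hq0
    set ℓb : ℝ := Real.log q.1 with hℓbdef
    set ℓk : ℝ := Real.log q.2 with hℓkdef
    have hℓb_hi : ℓb ≤ Lb := Real.log_le_log hb0 hqx
    have hℓb_lo : (1 - η) * Lb ≤ ℓb := by
      have h1 : x ^ (1 - η) < q.1 := lt_of_le_of_lt hAlo hAq
      have h2 := Real.log_lt_log (Real.rpow_pos_of_pos hx0 _) h1
      rw [hxη, Real.log_exp] at h2
      exact h2.le
    have hlog368 : Real.log (368 * (q.1 : ℝ) ^ 2) = Real.log 368 + 2 * ℓb := by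
      rw [Real.log_mul (by norm_num) (by positivity), Real.log_pow]; push_cast; ring
    have hlogM : Real.log (110592 * (q.1 : ℝ) ^ 6 * (q.2 : ℝ) ^ 12) =
        Real.log 110592 + 6 * ℓb + 12 * ℓk := by
      rw [Real.log_mul (by positivity) (by positivity), Real.log_mul (by norm_num) (by positivity),
        Real.log_pow, Real.log_pow]; push_cast; ring
    have hlogb2 : Real.log ((q.1 : ℝ) ^ 2) = 2 * ℓb := by rw [Real.log_pow]; push_cast; ring
    refine sc_mem_windowNoMin (by linarith) hqp hq29 hq0 ?_ ?_ ?_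
    · rw [hXdef]; exact mul_le_mul_of_nonneg_left (pow_le_pow_left₀ hb0.le hqx 2) (by norm_num)
    · rw [hlog368, hlogM]
      have e : 12 * ℓ₁ = κ * Real.log 368 + (2 * κ - 6 + 6 * η) * Lb - Real.log 110592 := by
        rw [hℓ₁def]; ring
      have h2 : κ * (2 * ℓb) ≤ κ * (2 * Lb) := mul_le_mul_of_nonneg_left (by linarith) (by linarith)
      linarith [hℓb_lo, hk1, e, h2, hη0]
    · rw [hlogM, hlogb2]
      have e : 12 * ℓ₂ = 8 * (1 - η) * Lb - Real.log 110592 := by rw [hℓ₂def]; ring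
      linarith [hℓb_lo, hk2, e]
  have hinj : Set.InjOn (fun q : ℕ × ℕ => sc q.1 q.2) ↑S := by
    intro q hq q' hq' h
    obtain ⟨hqp, -, -, -, hq0, -⟩ := hmemS q hq
    obtain ⟨hqp', -, -, -, hq0', -⟩ := hmemS q' hq'
    obtain ⟨h1, h2⟩ := sc_injective hqp hqp' hq0 hq0' h
    exact Prod.ext h1 h2
  have hcount : (S.card : ℝ) ≤ (Set.ncard (windowNoMin κ 7 X) : ℝ) := by
    have hsub : (↑(S.image fun q : ℕ × ℕ => sc q.1 q.2) : Set (WeierstrassCurve ℤ)) ⊆ windowNoMin κ 7 X := by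
      intro W hW
      rw [Finset.coe_image] at hW
      obtain ⟨q, hq, rfl⟩ := hW
      exact hmem q hq
    have h1 : S.card = (S.image fun q : ℕ × ℕ => sc q.1 q.2).card := (Finset.card_image_of_injOn hinj).symm
    have h2 : (S.image fun q : ℕ × ℕ => sc q.1 q.2).card =
        Set.ncard (↑(S.image fun q : ℕ × ℕ => sc q.1 q.2) : Set (WeierstrassCurve ℤ)) :=
      (Set.ncard_coe_finset _).symm
    have h3 := Set.ncard_le_ncard hsub (windowNoMin_finite _ _ _)
    exact_mod_cast (h1.trans h2).le.trans h3
  -- sizes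
  have hScard : (S.card : ℝ) = (primesIoc A B).card * (Ks.card : ℝ) := by
    rw [hSdef, Finset.card_product]; push_cast; ring
  set Np : ℝ := ((primesIoc A B).card : ℝ) with hNpdef
  have hNp0 : 0 ≤ Np := Nat.cast_nonneg _
  have hNp : x / 4 ≤ Np * Lb := hsup
  -- the law at `X`
  have hL := hlaw X hX1
  have hX0 : 0 < X := by linarith
  have hXδ : X ^ δ ≤ 20 * Real.exp (2 * δ * Lb) := by
    rw [Real.rpow_def_of_pos hX0, hXdef, Real.log_mul (by norm_num) (by positivity), Real.log_pow]
    have h368 : Real.log 368 * δ ≤ Real.log 400 * (1 / 2) := by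
      have h1 : Real.log 368 ≤ Real.log 400 := Real.log_le_log (by norm_num) (by norm_num)
      have h2 : 0 ≤ Real.log 368 := Real.log_nonneg (by norm_num)
      have h3 : Real.log 368 * δ ≤ Real.log 368 * (1 / 2) := mul_le_mul_of_nonneg_left hδ2.le h2
      linarith
    have h400 : Real.log 400 * (1 / 2) = Real.log 20 := by
      rw [show (400 : ℝ) = 20 ^ 2 by norm_num, Real.log_pow]; push_cast; ring
    have : Real.exp ((Real.log 368 + ((2 : ℕ) : ℝ) * Real.log x) * δ) ≤
        Real.exp (Real.log 20 + 2 * δ * Lb) := by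
      apply Real.exp_le_exp.mpr
      have hL : Lb = Real.log x := hLbdef
      push_cast
      nlinarith [h368, h400, hL]
    rwa [Real.exp_add, Real.exp_log (by norm_num)] at this
  -- `exp ℓ₂ ≥ x^{2(1-η)/3} / 3`
  have hℓ₂exp : Real.exp (2 * (1 - η) / 3 * Lb) / 3 ≤ Real.exp ℓ₂ := by
    have h110 : Real.log 110592 ≤ 12 * Real.log 3 := by
      have e : Real.log ((3 : ℝ) ^ 12) = 12 * Real.log 3 := by rw [Real.log_pow]; norm_num
      rw [← e]; exact Real.log_le_log (by norm_num) (by norm_num)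
    have h3 : Real.exp (2 * (1 - η) / 3 * Lb) ≤ 3 * Real.exp ℓ₂ := by
      calc Real.exp (2 * (1 - η) / 3 * Lb) ≤ Real.exp (Real.log 3 + ℓ₂) :=
            Real.exp_le_exp.mpr (by rw [hℓ₂def]; linarith)
        _ = 3 * Real.exp ℓ₂ := by rw [Real.exp_add, Real.exp_log (by norm_num)]
    rw [div_le_iff₀ (by norm_num : (0:ℝ) < 3)]; linarith
  -- the main inequality in exponential form
  have hpow : (B : ℝ) ^ (2 * (1 - (7 - κ) / 14) / 3 + 1 - 2 * δ) =
      Real.exp (2 * (1 - η) / 3 * Lb) * x * Real.exp (-(2 * δ * Lb)) := by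
    rw [← hηdef, ← hxdef, Real.rpow_def_of_pos hx0, ← hLbdef]
    rw [show Real.log x * (2 * (1 - η) / 3 + 1 - 2 * δ) = 2 * (1 - η) / 3 * Lb + Lb + -(2 * δ * Lb) by
      rw [hLbdef]; ring, Real.exp_add, Real.exp_add, Real.exp_log hx0]
  rw [hpow] at hmain
  -- combine: `S.card ≥ (x/(4Lb)) · exp ℓ₂ / 2` and `S.card ≤ C · 20 · exp(2δLb)`
  have hE0 : 0 < Real.exp (2 * δ * Lb) := Real.exp_pos _
  have hEneg : Real.exp (-(2 * δ * Lb)) * Real.exp (2 * δ * Lb) = 1 := by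
    rw [← Real.exp_add]; simp
  have h1 : (S.card : ℝ) ≤ C * (20 * Real.exp (2 * δ * Lb)) :=
    (hcount.trans hL).trans (mul_le_mul_of_nonneg_left hXδ hC0.le)
  have h2 : Np * (Real.exp ℓ₂ / 2) ≤ (S.card : ℝ) := by
    rw [hScard]; exact mul_le_mul_of_nonneg_left hKs_card hNp0
  -- `Np · Lb ≥ x/4`, so `x · exp ℓ₂ / 8 ≤ S.card · Lb ≤ 20 C Lb exp(2δLb)`
  have h3 : x * Real.exp ℓ₂ / 8 ≤ (S.card : ℝ) * Lb := by
    have := mul_le_mul_of_nonneg_right h2 hLb0.le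
    have h4 : x / 4 * (Real.exp ℓ₂ / 2) ≤ Np * Lb * (Real.exp ℓ₂ / 2) :=
      mul_le_mul_of_nonneg_right hNp (by positivity)
    linarith
  have h5 : x * Real.exp ℓ₂ / 8 ≤ 20 * C * Lb * Real.exp (2 * δ * Lb) := by
    have := mul_le_mul_of_nonneg_right h1 hLb0.le
    linarith
  -- from `hmain`: `500 C Lb ≤ exp(2(1-η)Lb/3) · x · exp(-2δLb)`; multiply by `exp(2δLb)`
  have h6 : 500 * C * Lb * Real.exp (2 * δ * Lb) ≤ Real.exp (2 * (1 - η) / 3 * Lb) * x := by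
    have := mul_le_mul_of_nonneg_right hmain hE0.le
    rw [mul_assoc (Real.exp (2 * (1 - η) / 3 * Lb) * x), hEneg, mul_one] at this
    exact this
  have h7 : Real.exp (2 * (1 - η) / 3 * Lb) * x ≤ 3 * Real.exp ℓ₂ * x := by
    have := mul_le_mul_of_nonneg_right hℓ₂exp hx0.le
    linarith
  have hpos : 0 < Real.exp ℓ₂ * x := mul_pos (Real.exp_pos _) hx0
  linarith [h5, h6, h7, hpos]

/-- **Minimality is load-bearing for `ModerateWindowCount`**: with "minimal at every place" dropped the
statement is FALSE (instance `σ = 7`; every `κ ∈ (3,7)`, `δ < (7−κ)/8` refuted by the rescalings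
`sc b k` of the prime twists `tw b`). -/
theorem moderateWindowCount_false_without_minimality : ¬ ModerateWindowCountWithoutMinimality := by
  intro h
  obtain ⟨κ, δ₀, C₀, hκ3, hκ7, hδ₀, hlaw₀⟩ := h 7 (by norm_num)
  set δ : ℝ := max δ₀ 0 with hδdef
  have hδ0 : 0 ≤ δ := le_max_right _ _
  have hδ : δ < (7 - κ) / 8 := by
    have e : (7 - κ) / (2 * 7 - 6) = (7 - κ) / 8 := by norm_num
    rw [e] at hδ₀
    exact max_lt hδ₀ (div_pos (by linarith) (by norm_num))
  set C : ℝ := max C₀ 1 with hCdef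
  have hC1 : 1 ≤ C := le_max_right _ _
  have hC0 : 0 < C := by linarith
  have hlaw : ∀ X : ℝ, 1 ≤ X → (Set.ncard (windowNoMin κ 7 X) : ℝ) ≤ C * X ^ δ := by
    intro X hX
    refine (hlaw₀ X hX).trans ?_
    have hXδ : X ^ δ₀ ≤ X ^ δ := Real.rpow_le_rpow_of_exponent_le hX (le_max_left _ _)
    have h0 : 0 ≤ X ^ δ₀ := Real.rpow_nonneg (by linarith) _
    calc C₀ * X ^ δ₀ ≤ C * X ^ δ₀ := mul_le_mul_of_nonneg_right (le_max_left _ _) h0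
      _ ≤ C * X ^ δ := mul_le_mul_of_nonneg_left hXδ (by linarith)
  obtain ⟨T₀, hT₀⟩ := primesIoc_card_mul_log_ge
  set η : ℝ := (7 - κ) / 14 with hηdef
  have hη0 : 0 < η := by rw [hηdef]; linarith
  have hη1 : 0 < 1 - η := by rw [hηdef]; linarith
  set e₁ : ℝ := 2 * (1 - (7 - κ) / 14) / 3 + 1 - 2 * δ with he₁def
  have he₁ : 0 < e₁ := by
    rw [he₁def]
    have : δ < 1 / 2 := by
      have : (7 - κ) / 8 < 1 / 2 := by rw [div_lt_iff₀ (by norm_num)]; linarith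
      linarith
    have : 0 < 1 - (7 - κ) / 14 := by linarith
    nlinarith
  have hK : 0 < 500 * C := by positivity
  have hev : ∀ᶠ x : ℝ in Filter.atTop, (T₀ : ℝ) ≤ x ∧ 29 ≤ x ^ (1 - η) ∧ 6 * x ^ (1 - η) + 7 ≤ x ∧
      κ * Real.log 368 + 12 * Real.log 4 ≤ (7 - κ) * Real.log x ∧
      Real.log 110592 ≤ (2 * κ - 6 + 6 * η) * Real.log x ∧
      500 * C * Real.log x ≤ x ^ e₁ := by
    refine (Filter.eventually_ge_atTop _).and ?_
    refine ((tendsto_rpow_atTop hη1).eventually_ge_atTop 29).and ?_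
    refine Filter.Eventually.and ?_ ?_
    · -- `6 x^{1-η} + 7 ≤ x`: from `x^η ≥ 13` and `x = x^{1-η} x^η`
      filter_upwards [(tendsto_rpow_atTop hη0).eventually_ge_atTop 13, Filter.eventually_ge_atTop (1 : ℝ)]
        with x hx hx1
      have hx0 : 0 < x := by linarith
      have h1 : x = x ^ (1 - η) * x ^ η := by rw [← Real.rpow_add hx0]; norm_num
      have h2 : 1 ≤ x ^ (1 - η) := Real.one_le_rpow hx1 (by linarith)
      have h3 : x ^ (1 - η) * 13 ≤ x ^ (1 - η) * x ^ η := mul_le_mul_of_nonneg_left hx (by linarith)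
      linarith
    refine Filter.Eventually.and ?_ ?_
    · exact (Real.tendsto_log_atTop.const_mul_atTop (by linarith : (0:ℝ) < 7 - κ)).eventually_ge_atTop
        (κ * Real.log 368 + 12 * Real.log 4)
    refine Filter.Eventually.and ?_ ?_
    · have h26 : (0:ℝ) < 2 * κ - 6 + 6 * η := by nlinarith
      exact (Real.tendsto_log_atTop.const_mul_atTop h26).eventually_ge_atTop _
    · refine ((isLittleO_log_rpow_atTop he₁).bound (inv_pos.mpr hK)).mp ?_
      filter_upwards [Filter.eventually_ge_atTop (1 : ℝ)] with x hx h
      rw [Real.norm_eq_abs, Real.norm_eq_abs, abs_of_nonneg (Real.log_nonneg hx),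
        abs_of_nonneg (Real.rpow_nonneg (by linarith) _)] at h
      have := mul_le_mul_of_nonneg_left h hK.le
      rwa [← mul_assoc, mul_inv_cancel₀ hK.ne', one_mul] at this
  obtain ⟨x₀, hx₀⟩ := Filter.eventually_atTop.mp hev
  set B : ℕ := ⌈max x₀ 1⌉₊ with hBdef
  have hBx : x₀ ≤ (B : ℝ) := (le_max_left _ _).trans (Nat.le_ceil _)
  obtain ⟨hBT, h29, hA, hℓ, hℓ₁, hmain⟩ := hx₀ B hBx
  have hBT' : T₀ ≤ B := by exact_mod_cast hBT
  exact noMin_core hκ3 hκ7 hδ hC1 hlaw hT₀ hBT' h29 hA hℓ hℓ₁ hmain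

/-! ## 7. Reducedness is an HONESTY clause (re-certified for this crux): without it, trivially TRUE

Without `a₁, a₃ ∈ {0,1}`, `a₂ ∈ {−1,0,1}` every member comes with all its integral translates `x ↦ x + r`
(same curve, conductor, `c₄, c₆, Δ`, still minimal at every place since `u = 1`), so each unreduced window
is empty or infinite, its `ncard` is `0`, and the `∃ κ δ C` statement holds with `C = 0`. (Port of the
sibling file's §8 to the `∃κ` form of this crux; general DVR lemma `isMinimal_smul_of_u_eq_one`.) -/

section MinimalInvariance

variable {R : Type*} [CommRing R] [IsDomain R] [IsDiscreteValuationRing R]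
  {K : Type*} [Field K] [Algebra R K] [IsFractionRing R K]

/-- Minimality (Mathlib's `IsMinimal`, a `MaximalFor` over all changes of variables) is preserved by a
change of variables with `u = 1` onto an integral equation. -/
theorem isMinimal_smul_of_u_eq_one (W : WeierstrassCurve K) [hW : W.IsMinimal R]
    (D : VariableChange K) (hu : D.u = 1) (hint : (D • W).IsIntegral R) : (D • W).IsMinimal R := by
  have hmax := hW.val_Δ_maximal
  haveI : W.IsIntegral R := inferInstance
  have hΔ : (D • W).Δ = W.Δ := by rw [variableChange_Δ, hu]; simp
  have hval : valuation_Δ_aux R (D • W) = valuation_Δ_aux R W := by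
    apply Subtype.ext
    have h1 := valuation_Δ_aux_eq_of_isIntegral R (D • W)
    have h2 := valuation_Δ_aux_eq_of_isIntegral R W
    rw [h1, h2, hΔ]
  refine ⟨⟨by simpa using hint, ?_⟩⟩
  intro C hC hle
  simp only [smul_smul, one_mul] at hC hle ⊢
  rw [hval] at hle ⊢
  have h2 := hmax.2 hC
  simp only [one_smul] at h2
  exact h2 hle

end MinimalInvariance

/-- Integral translate `x ↦ x + r` of an integral model (`u = 1`, `s = t = 0`). -/
def tr (W₀ : WeierstrassCurve ℤ) (r : ℤ) : WeierstrassCurve ℤ :=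
  ⟨W₀.a₁, W₀.a₂ + 3 * r, W₀.a₃ + r * W₀.a₁, W₀.a₄ + 2 * r * W₀.a₂ + 3 * r ^ 2,
    W₀.a₆ + r * W₀.a₄ + r ^ 2 * W₀.a₂ + r ^ 3⟩

/-- The translating change of variables over `ℚ`. -/
def trVC (r : ℤ) : VariableChange ℚ := ⟨1, (r : ℚ), 0, 0⟩

/-- `tr W₀ r ⊗ ℚ = trVC r • (W₀ ⊗ ℚ)`. -/
theorem tr_baseChange (W₀ : WeierstrassCurve ℤ) (r : ℤ) :
    (tr W₀ r).baseChange ℚ = trVC r • W₀.baseChange ℚ := by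
  ext
  · simp [tr, trVC, baseChange, variableChange_a₁]
  · simp [tr, trVC, baseChange, variableChange_a₂]
  · simp [tr, trVC, baseChange, variableChange_a₃]
  · simp [tr, trVC, baseChange, variableChange_a₄]
  · simp [tr, trVC, baseChange, variableChange_a₆]

/-- Translation preserves `c₄`. -/
theorem tr_c₄ (W₀ : WeierstrassCurve ℤ) (r : ℤ) : (tr W₀ r).c₄ = W₀.c₄ := by
  simp only [tr, WeierstrassCurve.c₄, WeierstrassCurve.b₂, WeierstrassCurve.b₄]; ring

/-- Translation preserves `c₆`. -/
theorem tr_c₆ (W₀ : WeierstrassCurve ℤ) (r : ℤ) : (tr W₀ r).c₆ = W₀.c₆ := by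
  simp only [tr, WeierstrassCurve.c₆, WeierstrassCurve.b₂, WeierstrassCurve.b₄, WeierstrassCurve.b₆]; ring

/-- Translation preserves `Δ`. -/
theorem tr_Δ (W₀ : WeierstrassCurve ℤ) (r : ℤ) : (tr W₀ r).Δ = W₀.Δ := by
  simp only [tr, WeierstrassCurve.Δ, WeierstrassCurve.b₂, WeierstrassCurve.b₄, WeierstrassCurve.b₆,
    WeierstrassCurve.b₈]; ring

/-- Translation preserves ellipticity. -/
theorem tr_isElliptic (W₀ : WeierstrassCurve ℤ) [h : (W₀.baseChange ℚ).IsElliptic] (r : ℤ) :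
    ((tr W₀ r).baseChange ℚ).IsElliptic := by
  refine ⟨?_⟩
  have := h.isUnit
  rw [baseChange_int_Δ] at this ⊢
  rwa [tr_Δ]

/-- Translation preserves the conductor (a `ℚ`-isomorphism invariant). -/
theorem tr_conductorNorm (W₀ : WeierstrassCurve ℤ) [(W₀.baseChange ℚ).IsElliptic] (r : ℤ) :
    ((tr W₀ r).baseChange ℚ).conductorNorm ℤ = (W₀.baseChange ℚ).conductorNorm ℤ := by
  rw [tr_baseChange]; exact conductorNorm_smul_rat _ _

/-- Translates of a minimal model are minimal. -/
theorem tr_isMinimalAt (W₀ : WeierstrassCurve ℤ) (v : HeightOneSpectrum ℤ)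
    (h : (W₀.baseChange ℚ).IsMinimalAt v) (r : ℤ) : ((tr W₀ r).baseChange ℚ).IsMinimalAt v := by
  have key : ((tr W₀ r).baseChange ℚ).baseChange (v.adicCompletion ℚ) =
      ((trVC r).baseChange (v.adicCompletion ℚ)) • (W₀.baseChange ℚ).baseChange (v.adicCompletion ℚ) := by
    rw [tr_baseChange]
    simp only [baseChange, VariableChange.baseChange, map_variableChange]
  have hint : (((trVC r).baseChange (v.adicCompletion ℚ)) •
      (W₀.baseChange ℚ).baseChange (v.adicCompletion ℚ)).IsIntegral (v.adicCompletionIntegers ℚ) := by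
    rw [← key]; exact isIntegralAt_baseChange_int v (tr W₀ r)
  unfold IsMinimalAt at h ⊢
  rw [key]
  haveI := h
  exact isMinimal_smul_of_u_eq_one _ _ (by simp [trVC, VariableChange.baseChange, VariableChange.map]) hint

/-- `r ↦ tr W₀ r` is injective (read `r` off `a₂`). -/
theorem tr_injective (W₀ : WeierstrassCurve ℤ) : Function.Injective (tr W₀) := by
  intro r r' h
  have h2 : (tr W₀ r).a₂ = (tr W₀ r').a₂ := by rw [h]
  simp only [tr] at h2
  omega

/-- The crux window WITHOUT the reducedness clauses. -/
def windowUnred (κ σ X : ℝ) : Set (WeierstrassCurve ℤ) :=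
  {W₀ : WeierstrassCurve ℤ | (W₀.baseChange ℚ).IsElliptic ∧
    (∀ v : HeightOneSpectrum ℤ, (W₀.baseChange ℚ).IsMinimalAt v) ∧
    W₀.c₄ ≠ 0 ∧ W₀.c₆ ≠ 0 ∧
    (((W₀.baseChange ℚ).conductorNorm ℤ : ℕ) : ℝ) ≤ X ∧
    (((W₀.baseChange ℚ).conductorNorm ℤ : ℕ) : ℝ) ^ κ ≤ ((max |W₀.Δ| (|W₀.c₄| ^ 3) : ℤ) : ℝ) ∧
    ((max |W₀.Δ| (|W₀.c₄| ^ 3) : ℤ) : ℝ) ≤ (((W₀.baseChange ℚ).conductorNorm ℤ : ℕ) : ℝ) ^ σ}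

/-- Every translate of a member of an unreduced window is a member. -/
theorem tr_mem_windowUnred {κ σ X : ℝ} {W₀ : WeierstrassCurve ℤ} (h : W₀ ∈ windowUnred κ σ X) (r : ℤ) :
    tr W₀ r ∈ windowUnred κ σ X := by
  obtain ⟨hE, hmin, hc₄, hc₆, hNX, hlo, hhi⟩ := h
  haveI := hE
  refine ⟨tr_isElliptic W₀ r, fun v => tr_isMinimalAt W₀ v (hmin v) r, ?_, ?_, ?_, ?_, ?_⟩
  · rwa [tr_c₄]
  · rwa [tr_c₆]
  · rwa [tr_conductorNorm]
  · rwa [tr_conductorNorm, tr_Δ, tr_c₄]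
  · rwa [tr_conductorNorm, tr_Δ, tr_c₄]

/-- Every unreduced window is empty or infinite, so its `ncard` is `0`. -/
theorem windowUnred_ncard (κ σ X : ℝ) : Set.ncard (windowUnred κ σ X) = 0 := by
  rcases (windowUnred κ σ X).eq_empty_or_nonempty with h | ⟨W₀, hW₀⟩
  · rw [h, Set.ncard_empty]
  · apply Set.Infinite.ncard
    exact Set.infinite_of_injective_forall_mem (tr_injective W₀) (fun r => tr_mem_windowUnred hW₀ r)

/-- `ModerateWindowCount` with the reducedness clauses removed. -/
def ModerateWindowCountUnreduced : Prop :=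
  ∀ σ : ℝ, 6 < σ → ∃ κ δ C : ℝ, 3 < κ ∧ κ < σ ∧ δ < (σ - κ) / (2 * σ - 6) ∧
    ∀ X : ℝ, 1 ≤ X → (Set.ncard (windowUnred κ σ X) : ℝ) ≤ C * X ^ δ

/-- **Reducedness is an honesty clause**: the unreduced statement is TRIVIALLY true (`κ := (σ+6)/2`,
`δ := 0`, `C := 0`; every count is `0`). -/
theorem moderateWindowCountUnreduced_trivial : ModerateWindowCountUnreduced := by
  intro σ hσ
  refine ⟨(σ + 6) / 2, 0, 0, by linarith, by linarith, div_pos (by linarith) (by linarith), fun X _ => ?_⟩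
  rw [windowUnred_ncard]; simp

/-! ## 5. Hypothesis audit of the TARGET as typed (paper, with pointers; complements the sibling file)

For `ModerateWindowCount` the prover chooses `κ`, so a dropped clause only matters if it creates abundance at
ratios ARBITRARILY CLOSE TO `σ > 6` (cf. §3: with `κ ∈ (6, σ)` only generalized-Szpiro violators count).
* `c₄ ≠ 0` dropped (j = 0 admitted): on a reduced minimal model with `c₄ = 0`, `Δ = −c₆²/1728`, every prime
  `p ≥ 5` of `Δ` is additive (`p ∣ c₄`) so `p² ∣ N`, and minimality gives `v_p(Δ) = 2 v_p(c₆) ≤ 10`; hence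
  `|Δ| ≤ 6¹¹ · N⁵`-type bounds: ratio `≤ 5 + O(1/log N)`. Windows with `κ > 5` gain finitely many curves:
  NOT load-bearing for MWC (it IS for `SharpModerateLaw`, sibling §5: `cm b = y² = x³ + b⁵`, ratio → 5).
* `c₆ ≠ 0` dropped (j = 1728): `M⁺ = |c₄|³ = 1728|Δ|`, `v_p(c₄) ≤ 3` at additive `p ≥ 5`, ratio `≤ 9/2 + o(1)`:
  NOT load-bearing for MWC (sibling §6 for the sharp law).
* minimality dropped: rescalings `u = 1/m` multiply `M⁺` by `m¹²` at fixed `N`; a curve of ratio `β` then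
  contributes members at every ratio `≥ β`, in particular beyond `6` — LOAD-BEARING, CERTIFIED in §6
  (`moderateWindowCount_false_without_minimality`, σ = 7, all κ ∈ (3,7)).
* reducedness dropped: every window is empty or infinite (integral translates), `ncard = 0`, statement
  TRIVIALLY TRUE — CERTIFIED in §7 (`moderateWindowCountUnreduced_trivial`).
* `κ < σ` dropped: TRIVIALLY TRUE (§2 here). `3 < κ` dropped: only MORE choices for the prover — harmless.
* `6 < σ`: SHARP (§4 here). `δ < (σ−κ)/(2σ−6)` replaced by `≤`: weaker statement, still ⟸ ABC; the
  threshold itself is attained at `σ = 6` by §4's family (so at `σ = 6` even `δ = (6−κ)/6 − η` fails ∀η>0).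
* conductor replaced by the radical `rad Δ_min`: FALSE for the sharp law (sibling §2: prime twists of one
  curve have radical-ratio `→ 6`, so they saturate `X/log X` in every window with `κ < 6`); for MWC as typed
  this only FORCES `κ > 6` (the prover's escape), where radical-MWC reduces to the radical form of Szpiro
  (`max|Δ| |c₄|³ ≪ rad(Δ)^{6+ε}`, again ⟸ abc) — not refutable, but any proof of the crux with `κ ≤ 6` must
  use `f_p = 2` at the additive primes of twists (`N = d² p rad k` vs `rad Δ = d p rad k` in §4).
* STRENGTHENINGS refuted/located: `σ = 6` (§4); `κ ≤ 6` forced with `σ > 6` ("intended" reading) — open, sits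
  strictly above the known sources (`X^{1−κ/6}` vs threshold, margin `(κ−3)(σ−6)/(3(2σ−6)) > 0`), equivalent
  to nothing known; uniform-in-σ constants — open.
* NEAR-MISSES: none left as `sorry`. What a KILL of the crux needs (and why none is coming): infinitely many
  reduced minimal models with `M⁺ ≥ N^{6+η}` for a fixed `η > 0` (then §4's twist bookkeeping with sources of
  ratio `6 + η` beats the threshold at `σ = 6 + η/2`), i.e. the negation of generalized Szpiro = ¬abc. -/
end

end Summit.ABC.ABC.Cruxes.ModerateWindowCount.Disproof
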